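import Summits.QuantumFields.YangMills.Theorems.BalabanUVNodesN15CurvedGluingSmoothCutDressedGluedDefect
import Summits.QuantumFields.YangMills.Theorems.BalabanUVNodesN15TwoSpacingGluingGradientGluing
import HarnessLib

/-!
# THE GLUING STEP AT TWO LATTICE SPACINGS — THE GRADIENT ENTRIES OF THE GLUED LIVE-BACKGROUND PROPAGATOR, I: the two-spacing η-defect of EVERY FLAT JET COMPONENT `∇^±_μ𝒢` of the glued
# operator of dag-n15-w3's dressed smooth-cut cubes with PER-CUBE perturbations and far defects, NO gauge sandwiches (the global-gauge edition of dag-n15-w3 48 with `∇^±_μ∘` in front)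
# (dag-n15-c g17, FILE 137a; N15 = NE2, s1 «background-layer OPERATOR ingredient»)

Cell `pub-ymgap`, seat `pub-ymgap-dag-n15-c` (R134 (a); HUMAN RULING D-0062), generation 17.  `bears_on: R4∕N15 · K3⁸ SpineGivenEndpointR13SepCoPHV (stmt-QuantumFields-27366)`.
Filed `--kind proof --supports stmt-QuantumFields-27366 --as helper` — COUNT-NEUTRAL.  Theorems only; 0 `def`, 0 `sorry`.  Imports BY NAME dag-n15-w3 45 `…CurvedGluingSmoothCutDressedGluedDefect`
(`gluedDefect_letters_nonneg`, `gluedDefect_r0a∕b∕c_nonneg`; through it 34∕35 `hasMaj_smoothCutDressed_loc₂`, `hasMaj_fgrad∕bgrad_smoothCutDressed_loc₂`, `hasMaj_idef_smoothCutDressed_loc₂`,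
`hasMaj_idef_jet_smoothCutDressed_loc₂`, `mulOp_comp_smoothCutDressed`, 38∕39 `hasMaj(_idef)_commOp_cubeOp_smoothCutDressed_in`, 33 `hasMaj(_idef)_dressedTail_out`, 23∕24 `hasMaj(_idef)_dressedV_pair`,
44 `weight_mul_exp_rate_mono`) and dag-n15-c FILE 136 `…TwoSpacingGluingGradientGluing` (`hasMaj_idef_comp_glued_of_cutRows_defect`; through it FILE 47 `fgrad∕bgrad_comp_mulOp`).  Nothing in the
tree is modified, no landed name re-declared.

WHY.  The live-background `NE2PlusOperator` family of g16 (FILES 131∕132∕135) has entries 0 (propagator) and 3 (Laplacian) CONSTRUCTED and the two GRADIENT entries of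
[Balaban1985BackgroundPropagators] (3.42) p. 397 DISPLAYED.  dag-n15-w3's two-grid capstone 48 (`hasMaj_idef_glueInv_smoothCutDressed_localGauges`) bounds `𝔇_π(𝒢′, 𝒢)` for the glued
operator `𝒢 = glueInv (Σ_kM_{h_k}X_kM_{h_k}) R̃` of the dressed smooth-cut cubes `X_k`; FILE 136 is the generic skeleton putting a derivative-type `D` with a lattice Leibniz rule through the
partition in front (`D∘𝒢 = (D∘G₀)(1 − R̃)⁻¹`).  THIS FILE feeds FILE 136 with 48's per-cube rows PLUS dag-n15-w3's per-cube JET rows — `∇^±_μX_k` (34 `hasMaj_fgrad∕bgrad_smoothCutDressed_loc₂`)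
and their η-defects (35 `hasMaj_idef_jet_smoothCutDressed_loc₂`) — and FILE 47's Leibniz `∇^±∘M_h = M_{h∘e^{±1}}∘∇^± + M_{∇^±h}`: ★★★ `hasMaj_idef_jet_glueInv_smoothCutDressed_cubes`, the
two-spacing η-defect `𝔇_π(∇′_j𝒢′, ∇_j𝒢)` of every flat jet component `j = ±μ`, in the GLOBAL-GAUGE edition (no per-cube gauge sandwiches `M_{W_k}` — the flat `∇^±` does not commute with
them; g16's finding: the honest sub-class of (3.35) for the flat nonlocal summand is the global gauge).  Binders = 48's minus the gauges∕gauge fit, with `M_{W_k}ΔM_{W_kᵀ} = …` read as `Δ = …`;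
the smallness letter `hq′` WITHOUT the `|ι|²` factors of the gauge rows; the shifted-partition fit `|h′∘e′ − (h∘e)∘π| ≤ oo + c₁η′ + c₁η` by the triangle (§1), as in 39.

WHAT.  §1 `abs_shift_fit(')` (real bookkeeping).  §2 ★★★ `hasMaj_idef_jet_glueInv_smoothCutDressed_cubes` — conclusion = FILE 136's explicit kernel at 48's letters (written out below; the sequel
instantiates it at the cover and bounds it by a certificate, as 123∕123b did for 53).

HONEST FRAMING ∕ LIMITS.  Composition of LANDED theorems over DISPLAYED rows on King's ∕ dag-n15-a's MODEL carriers (abstract lattice `X`, flat cubes `N_k`, bumps, partitions, perturbations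
`V̂_k`, far defects `F_k` — all hypotheses with located producers); the FLAT jet `∇^±_μ` (the covariant correction `M_a𝒢` of (3.42)'s `∇_U` is a bounded letter times entry 0 — not here);
nothing of [B5]∕[B6]∕[B9] asserted ((2.91)–(2.92) p.239, (2.133)–(2.136) p.247, (3.42) p.397, (3.62)–(3.65) pp.402–403, Thm 3.14 pp.426–427 = SHAPES ∕ MECHANISM ∕ TEMPLATE).  NE2⁺ NOT PRINTED,
NOT proved; N15 NOT discharged; K3⁸ OPEN, skeleton v6 untouched (0∕2); counts of record UNMOVED (typed 28∕28 · discharged 5∕27 · A 5∕28); one finite 𝕋⁴ at fixed ε — NOT infinite volume, NOT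
OS on ℝ⁴, NOT a mass gap, NOT Clay; R4 closes the conditional finite-𝕋⁴ rung `BalabanLadder.UV` only.  Restate-immune (no Theses import).
-/

set_option autoImplicit false

noncomputable section
open scoped BigOperators Matrix
open Finset

namespace Summit.QuantumFields.YangMills.BalabanUVNodes.N15.Gluing

open Literature.MathematicalPhysics.QuantumFieldTheory.Balaban1983to89
open Literature.MathematicalPhysics.QuantumFieldTheory.Balaban1983to89.B11SectG (BlockNorm HasMaj RowSum)
open Literature.MathematicalPhysics.QuantumFieldTheory.Balaban1983to89.B6RandomWalk (Triangle254)
open Literature.MathematicalPhysics.QuantumFieldTheory.Balaban1983to89.T4EtaRateDefect (idef idef_add)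
open Literature.MathematicalPhysics.QuantumFieldTheory.Balaban1983to89.T4EtaRateCoeffDefect (pull)
open Literature.MathematicalPhysics.QuantumFieldTheory.Balaban1983to89.B6Prop26Gluing (mulOp mulOp_apply ind ind_nonneg ind_le_one)
open Summit.QuantumFields.YangMills.BalabanUVNodes.N15.MatrixSpecies (liftBlk liftMap liftEquiv liftEquiv_apply liftEquiv_symm_apply)
open Summit.QuantumFields.YangMills.BalabanUVNodes.N15.BackgroundLayer (fgrad bgrad fgradAdj stack projO blkPair liftPair bgPropV fgrad_apply bgrad_apply)
open Summit.QuantumFields.YangMills.BalabanUVNodes.N15.CurvedSpecies (hasMaj_smoothCut_flat hasMaj_jet_smoothCut_flat hasMaj_idef_smoothCut_flat hasMaj_idef_jet_smoothCut_flat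
  hasMaj_dressedV_pair hasMaj_idef_dressedV_pair hasMaj_smoothCutDressed_loc₂ mulOp_comp_smoothCutDressed hasMaj_commOp_cubeOp_smoothCutDressed_in hasMaj_dressedTail_out
  hasMaj_idef_smoothCutDressed_loc₂ hasMaj_idef_commOp_cubeOp_smoothCutDressed_in hasMaj_idef_dressedTail_out weight_mul_exp_rate_mono gluedDefect_letters_nonneg gluedDefect_r0a_nonneg
  gluedDefect_r0b_nonneg gluedDefect_r0c_nonneg hasMaj_fgrad_smoothCutDressed_loc₂ hasMaj_bgrad_smoothCutDressed_loc₂ hasMaj_idef_jet_smoothCutDressed_loc₂)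

/-! ## §1 Real bookkeeping: the shifted partition's fit across the block map by the triangle -/

/-- `|a₁ − b₁| ≤ o + c∕n′ + c∕n` from `n′|a₁ − a| ≤ c`, `|a − b| ≤ o`, `n|b₁ − b| ≤ c` (`n, n′ > 0`) — the fit of a forward-shifted partition across the block map. [folklore] -/
theorem abs_shift_fit {a a₁ b b₁ n n' c o : ℝ} (hn : 0 < n) (hn' : 0 < n') (h1 : |n' * (a₁ - a)| ≤ c) (h2 : |a - b| ≤ o) (h3 : |n * (b₁ - b)| ≤ c) :
    |a₁ - b₁| ≤ o + c / n' + c / n := by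
  rw [abs_mul, abs_of_pos hn'] at h1
  rw [abs_mul, abs_of_pos hn] at h3
  have h1' : |a₁ - a| ≤ c / n' := by rw [le_div_iff₀ hn', mul_comm]; exact h1
  have h3' : |b₁ - b| ≤ c / n := by rw [le_div_iff₀ hn, mul_comm]; exact h3
  calc |a₁ - b₁| = |(a₁ - a) + (a - b) - (b₁ - b)| := by ring_nf
    _ ≤ |(a₁ - a) + (a - b)| + |b₁ - b| := abs_sub _ _
    _ ≤ |a₁ - a| + |a - b| + |b₁ - b| := by gcongr; exact abs_add_le _ _
    _ ≤ c / n' + o + c / n := by gcongr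
    _ = o + c / n' + c / n := by ring

/-- The backward-shift twin: `|a₁ − b₁| ≤ o + c∕n′ + c∕n` from `n′|a − a₁| ≤ c`, `|a − b| ≤ o`, `n|b − b₁| ≤ c`. [folklore] -/
theorem abs_shift_fit' {a a₁ b b₁ n n' c o : ℝ} (hn : 0 < n) (hn' : 0 < n') (h1 : |n' * (a - a₁)| ≤ c) (h2 : |a - b| ≤ o) (h3 : |n * (b - b₁)| ≤ c) :
    |a₁ - b₁| ≤ o + c / n' + c / n := by
  refine abs_shift_fit hn hn' ?_ h2 ?_
  · rwa [← abs_neg, ← mul_neg, neg_sub]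
  · rwa [← abs_neg, ← mul_neg, neg_sub]

/-! ## §2 The two-spacing η-defect of every flat jet component of the glued operator -/

variable {X X' ι J K : Type} [Fintype X] [Fintype X'] [DecidableEq X] [DecidableEq X'] [Fintype ι] [DecidableEq ι] [Fintype J] [DecidableEq J] [Fintype K] {g : B6.Geometry}
  (blk : X → g.Site) (π : X' → X) (τ : J → X ≃ X) (τ' : J → X' ≃ X') (n n' : ℝ) {σ cr : ℝ}
  {N : K → (X × ι → ℝ) →ₗ[ℝ] (X × ι → ℝ)} {N' : K → (X' × ι → ℝ) →ₗ[ℝ] (X' × ι → ℝ)} {V : K → ((X × ι) × Option (J ⊕ J) → ℝ) →ₗ[ℝ] (X × ι → ℝ)}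
  {V' : K → ((X' × ι) × Option (J ⊕ J) → ℝ) →ₗ[ℝ] (X' × ι → ℝ)} {Δ W NL : (X × ι → ℝ) →ₗ[ℝ] (X × ι → ℝ)} {Δ' W' NL' : (X' × ι → ℝ) →ₗ[ℝ] (X' × ι → ℝ)}
  {F : K → (X × ι → ℝ) →ₗ[ℝ] (X × ι → ℝ)} {F' : K → (X' × ι → ℝ) →ₗ[ℝ] (X' × ι → ℝ)}
  {χX χtX ψX hX : K → X → ℝ} {χX' χtX' ψX' hX' : K → X' → ℝ} {Sk : K → Set g.Site} {hb : K → g.Site → ℝ}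
  {β β₁ ct m₀ m₁ oχ oχ₁ oχ₂ δ : ℝ}

set_option maxHeartbeats 800000 in
/-- ★★★ **THE TWO-SPACING η-DEFECT OF EVERY FLAT JET COMPONENT OF THE GLUED LIVE-BACKGROUND PROPAGATOR, PER-CUBE PERTURBATIONS AND FAR DEFECTS, GLOBAL GAUGE** (dag-n15-w3 48 with
`∇^±_μ ∘` in front, no gauge sandwiches): under 48's displayed per-cube rows on both grids (cut rows `β, β₁` and their η-defects `m₀, m₁`, bumps `χ̃_k` with letters `c̃`, insertions and fits
`o_χ, o_χ₁, o_χ₂`, input cut-offs, partitions `h_k` (`|h| ≤ 1`, `M_hM_χ = M_h`, letters `c₁, c₂`, block reading `ℓ, ω`, fits `oo, o₁, o₂`), tail rows `ε₀` (defect `r_F`), `[N_L, M_h]` letters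
`c_N` (defect `r_N`), `W`-rows `θ_W` (defect `r_W`), perturbations `V̂_k, V̂′_k ≤ Re^{−δ_Vd}` (defect `o`), the operators `Δ = Σ∇*∇ + W + N_L − V̂_k∘jet + F_k` (both grids), far-defect rows
`θ_F, ε_F` (defects `r_{FK}, r_{FE}`), overlap `N_ov`, `β̄Rc_r² < 1`, `N_ov((θ₀+θ_F) + (ε̄+ε_F))c_r < 1`), for every jet index `j = ±μ`:
`𝔇_π(∇′_j∘𝒢′, ∇_j∘𝒢) ≤ [A((1−θc_r)⁻¹((1−θc_r)⁻¹r̂c_r)c_r)c_r + m̂(1−θc_r)⁻¹c_r]·e^{−(ρ₃−2σ)d}` with FILE 136's letters at `c_s = 1`, `c_d = c₁`, `β = β₁ = β̄′ = β̄(1−β̄Rc_r²)⁻¹`, `o_s = oo + c₁∕n′ + c₁∕n`,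
`o_d = o₁`, `m₀ = m₁ = A_D` (35's letter) — written out below.
[cite: Balaban1985BackgroundPropagators, (3.42) p.397 (gradient entries: shape), Thm 3.14 pp.426–427 (difference template), (3.62)–(3.65) pp.402–403; Balaban1984PropagatorsII, (2.91)–(2.92) p.239, (2.133)–(2.136) p.247 (mechanism); Balaban1984PropagatorsI, (1.2)–(1.3) p.18 (lattice Leibniz)] -/
theorem hasMaj_idef_jet_glueInv_smoothCutDressed_cubes (htri : Triangle254 g) (hd : ∀ a b : g.Site, 0 ≤ g.dist a b) (hd0 : ∀ y : g.Site, g.dist y y = 0)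
    (hsymm : ∀ y y', g.dist y y' = g.dist y' y) (hrow : RowSum g σ cr) (hσ : 0 ≤ σ) (hcr : 0 ≤ cr)
    {ρ₁ ρ₂ ρ₃ ρN ρT δV ε R o c₁ c₂ o₁ o₂ rW θW cN rN ℓ ω d₁ oo ε₀ rF Nov θF εF rFK rFE : ℝ} (hβ : 0 ≤ β) (hβ₁ : 0 ≤ β₁) (hct : 0 ≤ ct) (hm₀ : 0 ≤ m₀) (hm₁ : 0 ≤ m₁)
    (hoχ : 0 ≤ oχ) (hoχ₁ : 0 ≤ oχ₁) (hoχ₂ : 0 ≤ oχ₂) (hR : 0 ≤ R) (ho : 0 ≤ o) (hσρ : σ ≤ ρ₁) (hρ₁V : ρ₁ ≤ δV) (hρ₁G : ρ₁ + σ ≤ δ) (hρ₂ : 0 ≤ ρ₂) (hρ₂₁ : ρ₂ + σ ≤ ρ₁)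
    (hρ₂T : ρ₂ + σ ≤ ρT) (hρ₃ : 0 ≤ ρ₃) (hρ₃₂ : ρ₃ ≤ ρ₂) (hρ₃V : ρ₃ + σ ≤ δV - ε) (hρ₃N : ρ₃ + σ ≤ ρN) (hσρ₃ : 2 * σ ≤ ρ₃) (hε : 0 < ε) (hc₁ : 0 ≤ c₁) (hc₂ : 0 ≤ c₂)
    (ho₁ : 0 ≤ o₁) (ho₂ : 0 ≤ o₂) (hrW : 0 ≤ rW) (hθW : 0 ≤ θW) (hcN : 0 ≤ cN) (hrN : 0 ≤ rN) (hℓ : 0 ≤ ℓ) (hω : 0 ≤ ω) (hd₁ : 0 ≤ d₁) (hoo : 0 ≤ oo) (hε₀ : 0 ≤ ε₀)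
    (hrF : 0 ≤ rF) (hNov : 0 ≤ Nov) (hn : 0 < n) (hn' : 0 < n')
    (hSχ : ∀ k, ∀ x, (χX k) x ≠ 0 → blk x ∈ (Sk k)) (hSψ : ∀ k, ∀ x, (ψX k) x ≠ 0 → blk x ∈ (Sk k)) (hSχ' : ∀ k, ∀ x', (χX' k) x' ≠ 0 → blk (π x') ∈ (Sk k)) (hSψ' : ∀ k, ∀ x', (ψX' k) x' ≠ 0 → blk (π x') ∈ (Sk k))
    -- coarse bump data
    (hχt : ∀ k, ∀ x, |(χtX k) x| ≤ 1)
    (hdχt : ∀ k, ∀ μ p, |fgrad n (liftEquiv (τ μ) ι) (fun p : X × ι => (χtX k) p.1) p| ≤ ct) (hdχtb : ∀ k, ∀ μ p, |bgrad n (liftEquiv (τ μ) ι) (fun p : X × ι => (χtX k) p.1) p| ≤ ct)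
    (hsub : ∀ k, mulOp (fun p : X × ι => (χtX k) p.1) ∘ₗ mulOp (fun p : X × ι => (χX k) p.1) = mulOp (fun p : X × ι => (χtX k) p.1))
    (hχ : ∀ k, mulOp (fun p : X × ι => (χX k) p.1) ∘ₗ mulOp (fun p : X × ι => (χtX k) p.1) = mulOp (fun p : X × ι => (χtX k) p.1))
    (hs : ∀ k, ∀ μ, mulOp ((fun p : X × ι => (χtX k) p.1) ∘ (liftEquiv (τ μ) ι)) ∘ₗ mulOp (fun p : X × ι => (χX k) p.1) = mulOp ((fun p : X × ι => (χtX k) p.1) ∘ (liftEquiv (τ μ) ι)))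
    (hsb : ∀ k, ∀ μ, mulOp ((fun p : X × ι => (χtX k) p.1) ∘ (liftEquiv (τ μ) ι).symm) ∘ₗ mulOp (fun p : X × ι => (χX k) p.1) = mulOp ((fun p : X × ι => (χtX k) p.1) ∘ (liftEquiv (τ μ) ι).symm))
    (hdd : ∀ k, ∀ μ, mulOp (fgrad n (liftEquiv (τ μ) ι) (fun p : X × ι => (χtX k) p.1)) ∘ₗ mulOp (fun p : X × ι => (χX k) p.1) = mulOp (fgrad n (liftEquiv (τ μ) ι) (fun p : X × ι => (χtX k) p.1)))
    (hddb : ∀ k, ∀ μ, mulOp (bgrad n (liftEquiv (τ μ) ι) (fun p : X × ι => (χtX k) p.1)) ∘ₗ mulOp (fun p : X × ι => (χX k) p.1) = mulOp (bgrad n (liftEquiv (τ μ) ι) (fun p : X × ι => (χtX k) p.1)))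
    (hNψ : ∀ k, (N k) ∘ₗ mulOp (fun p : X × ι => (ψX k) p.1) = (N k))
    -- fine bump data
    (hχt' : ∀ k, ∀ x', |(χtX' k) x'| ≤ 1)
    (hdχt' : ∀ k, ∀ μ p', |fgrad n' (liftEquiv (τ' μ) ι) (fun p' : X' × ι => (χtX' k) p'.1) p'| ≤ ct) (hdχtb' : ∀ k, ∀ μ p', |bgrad n' (liftEquiv (τ' μ) ι) (fun p' : X' × ι => (χtX' k) p'.1) p'| ≤ ct)
    (hsub' : ∀ k, mulOp (fun p : X' × ι => (χtX' k) p.1) ∘ₗ mulOp (fun p : X' × ι => (χX' k) p.1) = mulOp (fun p : X' × ι => (χtX' k) p.1))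
    (hχ' : ∀ k, mulOp (fun p : X' × ι => (χX' k) p.1) ∘ₗ mulOp (fun p : X' × ι => (χtX' k) p.1) = mulOp (fun p : X' × ι => (χtX' k) p.1))
    (hs' : ∀ k, ∀ μ, mulOp ((fun p' : X' × ι => (χtX' k) p'.1) ∘ (liftEquiv (τ' μ) ι)) ∘ₗ mulOp (fun p' : X' × ι => (χX' k) p'.1) = mulOp ((fun p' : X' × ι => (χtX' k) p'.1) ∘ (liftEquiv (τ' μ) ι)))
    (hsb' : ∀ k, ∀ μ, mulOp ((fun p' : X' × ι => (χtX' k) p'.1) ∘ (liftEquiv (τ' μ) ι).symm) ∘ₗ mulOp (fun p' : X' × ι => (χX' k) p'.1) =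
      mulOp ((fun p' : X' × ι => (χtX' k) p'.1) ∘ (liftEquiv (τ' μ) ι).symm))
    (hdd' : ∀ k, ∀ μ, mulOp (fgrad n' (liftEquiv (τ' μ) ι) (fun p' : X' × ι => (χtX' k) p'.1)) ∘ₗ mulOp (fun p' : X' × ι => (χX' k) p'.1) = mulOp (fgrad n' (liftEquiv (τ' μ) ι) (fun p' : X' × ι => (χtX' k) p'.1)))
    (hddb' : ∀ k, ∀ μ, mulOp (bgrad n' (liftEquiv (τ' μ) ι) (fun p' : X' × ι => (χtX' k) p'.1)) ∘ₗ mulOp (fun p' : X' × ι => (χX' k) p'.1) = mulOp (bgrad n' (liftEquiv (τ' μ) ι) (fun p' : X' × ι => (χtX' k) p'.1)))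
    (hNψ' : ∀ k, (N' k) ∘ₗ mulOp (fun p : X' × ι => (ψX' k) p.1) = (N' k))
    -- fits of the bumps across `π`
    (hfitχ : ∀ k, ∀ x', |(χtX' k) x' - (χtX k) (π x')| ≤ oχ)
    (hfit₁ : ∀ k, ∀ μ p', |((fun p' : X' × ι => (χtX' k) p'.1) ∘ (liftEquiv (τ' μ) ι)) p' - ((fun p : X × ι => (χtX k) p.1) ∘ (liftEquiv (τ μ) ι)) (liftMap π ι p')| ≤ oχ₁)
    (hfit₁b : ∀ k, ∀ μ p', |((fun p' : X' × ι => (χtX' k) p'.1) ∘ (liftEquiv (τ' μ) ι).symm) p' - ((fun p : X × ι => (χtX k) p.1) ∘ (liftEquiv (τ μ) ι).symm) (liftMap π ι p')| ≤ oχ₁)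
    (hfit₂ : ∀ k, ∀ μ p', |fgrad n' (liftEquiv (τ' μ) ι) (fun p' : X' × ι => (χtX' k) p'.1) p' - fgrad n (liftEquiv (τ μ) ι) (fun p : X × ι => (χtX k) p.1) (liftMap π ι p')| ≤ oχ₂)
    (hfit₂b : ∀ k, ∀ μ p', |bgrad n' (liftEquiv (τ' μ) ι) (fun p' : X' × ι => (χtX' k) p'.1) p' - bgrad n (liftEquiv (τ μ) ι) (fun p : X × ι => (χtX k) p.1) (liftMap π ι p')| ≤ oχ₂)
    -- cut rows and their defects
    (hcut : ∀ k, HasMaj (BlockNorm.ofBlocks g (liftBlk blk ι)) (BlockNorm.ofBlocks g (liftBlk blk ι)) (mulOp (fun p : X × ι => (χX k) p.1) ∘ₗ (N k))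
      (fun y y' => ind (Sk k) y * ind (Sk k) y' * (β * Real.exp (-(δ * g.dist y y')))))
    (hcutF : ∀ k, ∀ μ, HasMaj (BlockNorm.ofBlocks g (liftBlk blk ι)) (BlockNorm.ofBlocks g (liftBlk blk ι)) (mulOp (fun p : X × ι => (χX k) p.1) ∘ₗ (fgrad n (liftEquiv (τ μ) ι) ∘ₗ (N k)))
      (fun y y' => ind (Sk k) y * ind (Sk k) y' * (β₁ * Real.exp (-(δ * g.dist y y')))))
    (hcutB : ∀ k, ∀ μ, HasMaj (BlockNorm.ofBlocks g (liftBlk blk ι)) (BlockNorm.ofBlocks g (liftBlk blk ι)) (mulOp (fun p : X × ι => (χX k) p.1) ∘ₗ (bgrad n (liftEquiv (τ μ) ι) ∘ₗ (N k)))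
      (fun y y' => ind (Sk k) y * ind (Sk k) y' * (β₁ * Real.exp (-(δ * g.dist y y')))))
    (hcut' : ∀ k, HasMaj (BlockNorm.ofBlocks g (liftBlk (blk ∘ π) ι)) (BlockNorm.ofBlocks g (liftBlk (blk ∘ π) ι)) (mulOp (fun p : X' × ι => (χX' k) p.1) ∘ₗ (N' k))
      (fun y y' => ind (Sk k) y * ind (Sk k) y' * (β * Real.exp (-(δ * g.dist y y')))))
    (hcutF' : ∀ k, ∀ μ, HasMaj (BlockNorm.ofBlocks g (liftBlk (blk ∘ π) ι)) (BlockNorm.ofBlocks g (liftBlk (blk ∘ π) ι)) (mulOp (fun p : X' × ι => (χX' k) p.1) ∘ₗ (fgrad n' (liftEquiv (τ' μ) ι) ∘ₗ (N' k)))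
      (fun y y' => ind (Sk k) y * ind (Sk k) y' * (β₁ * Real.exp (-(δ * g.dist y y')))))
    (hcutB' : ∀ k, ∀ μ, HasMaj (BlockNorm.ofBlocks g (liftBlk (blk ∘ π) ι)) (BlockNorm.ofBlocks g (liftBlk (blk ∘ π) ι)) (mulOp (fun p : X' × ι => (χX' k) p.1) ∘ₗ (bgrad n' (liftEquiv (τ' μ) ι) ∘ₗ (N' k)))
      (fun y y' => ind (Sk k) y * ind (Sk k) y' * (β₁ * Real.exp (-(δ * g.dist y y')))))
    (hDcut : ∀ k, HasMaj (BlockNorm.ofBlocks g (liftBlk blk ι)) (BlockNorm.ofBlocks g (liftBlk blk ι ∘ liftMap π ι))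
      (idef (pull (liftMap π ι)) (pull (liftMap π ι)) (mulOp (fun p : X' × ι => (χX' k) p.1) ∘ₗ (N' k)) (mulOp (fun p : X × ι => (χX k) p.1) ∘ₗ (N k)))
      (fun y y' => ind (Sk k) y * ind (Sk k) y' * (m₀ * Real.exp (-(δ * g.dist y y')))))
    (hDcutF : ∀ k, ∀ μ, HasMaj (BlockNorm.ofBlocks g (liftBlk blk ι)) (BlockNorm.ofBlocks g (liftBlk blk ι ∘ liftMap π ι))
      (idef (pull (liftMap π ι)) (pull (liftMap π ι)) (mulOp (fun p : X' × ι => (χX' k) p.1) ∘ₗ (fgrad n' (liftEquiv (τ' μ) ι) ∘ₗ (N' k))) (mulOp (fun p : X × ι => (χX k) p.1) ∘ₗ (fgrad n (liftEquiv (τ μ) ι) ∘ₗ (N k))))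
      (fun y y' => ind (Sk k) y * ind (Sk k) y' * (m₁ * Real.exp (-(δ * g.dist y y')))))
    (hDcutB : ∀ k, ∀ μ, HasMaj (BlockNorm.ofBlocks g (liftBlk blk ι)) (BlockNorm.ofBlocks g (liftBlk blk ι ∘ liftMap π ι))
      (idef (pull (liftMap π ι)) (pull (liftMap π ι)) (mulOp (fun p : X' × ι => (χX' k) p.1) ∘ₗ (bgrad n' (liftEquiv (τ' μ) ι) ∘ₗ (N' k))) (mulOp (fun p : X × ι => (χX k) p.1) ∘ₗ (bgrad n (liftEquiv (τ μ) ι) ∘ₗ (N k))))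
      (fun y y' => ind (Sk k) y * ind (Sk k) y' * (m₁ * Real.exp (-(δ * g.dist y y')))))
    -- the jet pieces' reversed insertions (output cut-offs), both grids
    (hs2 : ∀ k, ∀ μ, mulOp (fun p : X × ι => (χX k) p.1) ∘ₗ mulOp ((fun p : X × ι => (χtX k) p.1) ∘ (liftEquiv (τ μ) ι)) = mulOp ((fun p : X × ι => (χtX k) p.1) ∘ (liftEquiv (τ μ) ι)))
    (hsb2 : ∀ k, ∀ μ, mulOp (fun p : X × ι => (χX k) p.1) ∘ₗ mulOp ((fun p : X × ι => (χtX k) p.1) ∘ (liftEquiv (τ μ) ι).symm) = mulOp ((fun p : X × ι => (χtX k) p.1) ∘ (liftEquiv (τ μ) ι).symm))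
    (hdd2 : ∀ k, ∀ μ, mulOp (fun p : X × ι => (χX k) p.1) ∘ₗ mulOp (fgrad n (liftEquiv (τ μ) ι) (fun p : X × ι => (χtX k) p.1)) = mulOp (fgrad n (liftEquiv (τ μ) ι) (fun p : X × ι => (χtX k) p.1)))
    (hddb2 : ∀ k, ∀ μ, mulOp (fun p : X × ι => (χX k) p.1) ∘ₗ mulOp (bgrad n (liftEquiv (τ μ) ι) (fun p : X × ι => (χtX k) p.1)) = mulOp (bgrad n (liftEquiv (τ μ) ι) (fun p : X × ι => (χtX k) p.1)))
    (hs2' : ∀ k, ∀ μ, mulOp (fun p' : X' × ι => (χX' k) p'.1) ∘ₗ mulOp ((fun p' : X' × ι => (χtX' k) p'.1) ∘ (liftEquiv (τ' μ) ι)) = mulOp ((fun p' : X' × ι => (χtX' k) p'.1) ∘ (liftEquiv (τ' μ) ι)))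
    (hsb2' : ∀ k, ∀ μ, mulOp (fun p' : X' × ι => (χX' k) p'.1) ∘ₗ mulOp ((fun p' : X' × ι => (χtX' k) p'.1) ∘ (liftEquiv (τ' μ) ι).symm) =
      mulOp ((fun p' : X' × ι => (χtX' k) p'.1) ∘ (liftEquiv (τ' μ) ι).symm))
    (hdd2' : ∀ k, ∀ μ, mulOp (fun p' : X' × ι => (χX' k) p'.1) ∘ₗ mulOp (fgrad n' (liftEquiv (τ' μ) ι) (fun p' : X' × ι => (χtX' k) p'.1)) = mulOp (fgrad n' (liftEquiv (τ' μ) ι) (fun p' : X' × ι => (χtX' k) p'.1)))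
    (hddb2' : ∀ k, ∀ μ, mulOp (fun p' : X' × ι => (χX' k) p'.1) ∘ₗ mulOp (bgrad n' (liftEquiv (τ' μ) ι) (fun p' : X' × ι => (χtX' k) p'.1)) = mulOp (bgrad n' (liftEquiv (τ' μ) ι) (fun p' : X' × ι => (χtX' k) p'.1)))
    -- per cube, IN THE CUBE's GAUGES: the perturbations `V̂_k` (coarse), `V̂′_k` (fine) of the jets, their letters and their η-defect across `π`
    (hV : ∀ k, HasMaj (BlockNorm.ofBlocks g (blkPair (liftBlk blk ι))) (BlockNorm.ofBlocks g (liftBlk blk ι)) (V k) (fun y y' => R * Real.exp (-(δV * g.dist y y'))))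
    (hV' : ∀ k, HasMaj (BlockNorm.ofBlocks g (blkPair (liftBlk (blk ∘ π) ι))) (BlockNorm.ofBlocks g (liftBlk (blk ∘ π) ι)) (V' k) (fun y y' => R * Real.exp (-(δV * g.dist y y'))))
    (hDV : ∀ k, HasMaj (BlockNorm.ofBlocks g (blkPair (liftBlk blk ι))) (BlockNorm.ofBlocks g (liftBlk (blk ∘ π) ι))
      (idef (pull (liftPair (liftMap π ι))) (pull (liftMap π ι)) (V' k) (V k)) (fun y y' => o * Real.exp (-(δV * g.dist y y'))))
    (hq : (β + (β₁ + ct * β)) * (R * cr) * cr < 1)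
    (hh1 : ∀ k, ∀ μ p, |fgrad n (liftEquiv (τ μ) ι) (fun p : X × ι => hX k p.1) p| ≤ c₁) (hh1b : ∀ k, ∀ μ p, |bgrad n (liftEquiv (τ μ) ι) (fun p : X × ι => hX k p.1) p| ≤ c₁)
    (hh1' : ∀ k, ∀ μ p', |fgrad n' (liftEquiv (τ' μ) ι) (fun p : X' × ι => hX' k p.1) p'| ≤ c₁) (hh1b' : ∀ k, ∀ μ p', |bgrad n' (liftEquiv (τ' μ) ι) (fun p : X' × ι => hX' k p.1) p'| ≤ c₁)
    (hh2' : ∀ k, ∀ μ p', |fgradAdj n' (liftEquiv (τ' μ) ι) (fgrad n' (liftEquiv (τ' μ) ι) (fun p : X' × ι => hX' k p.1)) p'| ≤ c₂)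
    (hf1 : ∀ k, ∀ μ p', |fgrad n' (liftEquiv (τ' μ) ι) (fun p : X' × ι => hX' k p.1) p' - fgrad n (liftEquiv (τ μ) ι) (fun p : X × ι => hX k p.1) (liftMap π ι p')| ≤ o₁)
    (hf1b : ∀ k, ∀ μ p', |bgrad n' (liftEquiv (τ' μ) ι) (fun p : X' × ι => hX' k p.1) p' - bgrad n (liftEquiv (τ μ) ι) (fun p : X × ι => hX k p.1) (liftMap π ι p')| ≤ o₁)
    (hf2 : ∀ k, ∀ μ p', |fgradAdj n' (liftEquiv (τ' μ) ι) (fgrad n' (liftEquiv (τ' μ) ι) (fun p : X' × ι => hX' k p.1)) p' - fgradAdj n (liftEquiv (τ μ) ι) (fgrad n (liftEquiv (τ μ) ι) (fun p : X × ι => hX k p.1)) (liftMap π ι p')| ≤ o₂)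
    (hLip : ∀ k, ∀ y y', |(hb k) y - (hb k) y'| ≤ ℓ * g.dist y y') (hrh : ∀ k (p : X × ι), |hX k p.1 - (hb k) (liftBlk blk ι p)| ≤ ω) (hrh' : ∀ k (p' : X' × ι), |hX' k p'.1 - (hb k) (liftBlk (blk ∘ π) ι p')| ≤ ω)
    (hfh : ∀ k (p' : X' × ι), |hX' k p'.1 - hX k (π p'.1)| ≤ oo) (hstep : ∀ μ x, g.dist (blk (τ μ x)) (blk x) ≤ d₁) (hstep' : ∀ μ x', g.dist (blk (π (τ' μ x'))) (blk (π x')) ≤ d₁)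
    (hDW : ∀ k, HasMaj (BlockNorm.ofBlocks g (liftBlk blk ι)) (BlockNorm.ofBlocks g (liftBlk (blk ∘ π) ι))
      (idef (pull (liftMap π ι)) (pull (liftMap π ι)) (commOp W' (fun p : X' × ι => hX' k p.1) ∘ₗ (projO none ∘ₗ bgPropV (stack (mulOp (fun p : X' × ι => (χtX' k) p.1) ∘ₗ (N' k))
          (fun j => Sum.elim (fun μ => fgrad n' (liftEquiv (τ' μ) ι)) (fun μ => bgrad n' (liftEquiv (τ' μ) ι)) j ∘ₗ (mulOp (fun p : X' × ι => (χtX' k) p.1) ∘ₗ (N' k)))) (V' k))) (commOp W (fun p : X × ι => hX k p.1) ∘ₗ (projO none ∘ₗ bgPropV (stack (mulOp (fun p : X × ι => (χtX k) p.1) ∘ₗ (N k))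
          (fun j => Sum.elim (fun μ => fgrad n (liftEquiv (τ μ) ι)) (fun μ => bgrad n (liftEquiv (τ μ) ι)) j ∘ₗ (mulOp (fun p : X × ι => (χtX k) p.1) ∘ₗ (N k)))) (V k))))
      (fun y y' => ind (Sk k) y * ind (Sk k) y' * (rW * Real.exp (-(ρ₂ * g.dist y y')))))
    (hKN' : ∀ k, HasMaj (BlockNorm.ofBlocks g (liftBlk (blk ∘ π) ι)) (BlockNorm.ofBlocks g (liftBlk (blk ∘ π) ι)) (commOp NL' (fun p : X' × ι => hX' k p.1)) (fun y y' => cN * Real.exp (-(ρN * g.dist y y'))))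
    (hDKN : ∀ k, HasMaj (BlockNorm.ofBlocks g (liftBlk blk ι)) (BlockNorm.ofBlocks g (liftBlk (blk ∘ π) ι))
      (idef (pull (liftMap π ι)) (pull (liftMap π ι)) (commOp NL' (fun p : X' × ι => hX' k p.1)) (commOp NL (fun p : X × ι => hX k p.1))) (fun y y' => rN * Real.exp (-(ρN * g.dist y y'))))

    -- per cube, beyond file 39's data: the coarse second differences, the one-grid `W`-rows at both grids, the coarse `[N_L, M_h]` letter, the partition's sizes and cut support, the tail rows and their defect
    (hh2 : ∀ k, ∀ μ p, |fgradAdj n (liftEquiv (τ μ) ι) (fgrad n (liftEquiv (τ μ) ι) (fun p : X × ι => hX k p.1)) p| ≤ c₂)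
    (hW : ∀ k, HasMaj (BlockNorm.ofBlocks g (liftBlk blk ι)) (BlockNorm.ofBlocks g (liftBlk blk ι)) (commOp W (fun p : X × ι => hX k p.1) ∘ₗ (projO none ∘ₗ bgPropV (stack (mulOp (fun p : X × ι => χtX k p.1) ∘ₗ N k)
          (fun j => Sum.elim (fun μ => fgrad n (liftEquiv (τ μ) ι)) (fun μ => bgrad n (liftEquiv (τ μ) ι)) j ∘ₗ (mulOp (fun p : X × ι => χtX k p.1) ∘ₗ N k))) (V k)))
      (fun y y' => ind (Sk k) y * ind (Sk k) y' * (θW * Real.exp (-(ρ₂ * g.dist y y')))))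
    (hW' : ∀ k, HasMaj (BlockNorm.ofBlocks g (liftBlk (blk ∘ π) ι)) (BlockNorm.ofBlocks g (liftBlk (blk ∘ π) ι)) (commOp W' (fun p : X' × ι => hX' k p.1) ∘ₗ (projO none ∘ₗ bgPropV (stack (mulOp (fun p : X' × ι => χtX' k p.1) ∘ₗ N' k)
          (fun j => Sum.elim (fun μ => fgrad n' (liftEquiv (τ' μ) ι)) (fun μ => bgrad n' (liftEquiv (τ' μ) ι)) j ∘ₗ (mulOp (fun p : X' × ι => χtX' k p.1) ∘ₗ N' k))) (V' k)))
      (fun y y' => ind (Sk k) y * ind (Sk k) y' * (θW * Real.exp (-(ρ₂ * g.dist y y')))))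
    (hKN : ∀ k, HasMaj (BlockNorm.ofBlocks g (liftBlk blk ι)) (BlockNorm.ofBlocks g (liftBlk blk ι)) (commOp NL (fun p : X × ι => hX k p.1)) (fun y y' => cN * Real.exp (-(ρN * g.dist y y'))))
    (hhabs : ∀ k x, |hX k x| ≤ 1) (hhabs' : ∀ k x', |hX' k x'| ≤ 1)
    (hhcut : ∀ k, mulOp (fun p : X × ι => hX k p.1) ∘ₗ mulOp (fun p : X × ι => χX k p.1) = mulOp (fun p : X × ι => hX k p.1)) (hhcut' : ∀ k, mulOp (fun p : X' × ι => hX' k p.1) ∘ₗ mulOp (fun p : X' × ι => χX' k p.1) = mulOp (fun p : X' × ι => hX' k p.1))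
    (hN : ∀ b, ∑ k, ind (Sk k) b ≤ Nov)
    (hT : ∀ k, HasMaj (BlockNorm.ofBlocks g (liftBlk blk ι)) (BlockNorm.ofBlocks g (liftBlk blk ι)) ((-(mulOp (fun p : X × ι => hX k p.1) ∘ₗ NL ∘ₗ mulOp (1 - fun p : X × ι => χtX k p.1))) ∘ₗ N k) (fun y y' => ind (Sk k) y * ind (Sk k) y' * (ε₀ * Real.exp (-(ρT * g.dist y y')))))
    (hT' : ∀ k, HasMaj (BlockNorm.ofBlocks g (liftBlk (blk ∘ π) ι)) (BlockNorm.ofBlocks g (liftBlk (blk ∘ π) ι)) ((-(mulOp (fun p : X' × ι => hX' k p.1) ∘ₗ NL' ∘ₗ mulOp (1 - fun p : X' × ι => χtX' k p.1))) ∘ₗ N' k) (fun y y' => ind (Sk k) y * ind (Sk k) y' * (ε₀ * Real.exp (-(ρT * g.dist y y')))))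
    (hDT : ∀ k, HasMaj (BlockNorm.ofBlocks g (liftBlk blk ι)) (BlockNorm.ofBlocks g (liftBlk (blk ∘ π) ι)) (idef (pull (liftMap π ι)) (pull (liftMap π ι)) ((-(mulOp (fun p : X' × ι => hX' k p.1) ∘ₗ NL' ∘ₗ mulOp (1 - fun p : X' × ι => χtX' k p.1))) ∘ₗ N' k) ((-(mulOp (fun p : X × ι => hX k p.1) ∘ₗ NL ∘ₗ mulOp (1 - fun p : X × ι => χtX k p.1))) ∘ₗ N k)) (fun y y' => ind (Sk k) y * ind (Sk k) y' * (rF * Real.exp (-(ρT * g.dist y y')))))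
    -- both grids' operators = the cube's model operators up to far defects `F_k`, `F′_k` (no gauge sandwiches: the global-gauge edition); the far defects' rows against the cubes and their η-defects
    (hθF : 0 ≤ θF) (hεF : 0 ≤ εF) (hrFK : 0 ≤ rFK) (hrFE : 0 ≤ rFE)
    (hcov : ∀ k, Δ = (lapOp n (fun μ => liftEquiv (τ μ) ι) W + NL - V k ∘ₗ stack LinearMap.id (fun j => Sum.elim (fun μ => fgrad n (liftEquiv (τ μ) ι)) (fun μ => bgrad n (liftEquiv (τ μ) ι)) j)) + F k)
    (hcov' : ∀ k, Δ' = (lapOp n' (fun μ => liftEquiv (τ' μ) ι) W' + NL' - V' k ∘ₗ stack LinearMap.id (fun j => Sum.elim (fun μ => fgrad n' (liftEquiv (τ' μ) ι)) (fun μ => bgrad n' (liftEquiv (τ' μ) ι)) j)) + F' k)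
    (hFK : ∀ k, HasMaj (BlockNorm.ofBlocks g (liftBlk blk ι)) (BlockNorm.ofBlocks g (liftBlk blk ι)) (commOp (F k) (fun p : X × ι => hX k p.1) ∘ₗ (projO none ∘ₗ bgPropV (stack (mulOp (fun p : X × ι => χtX k p.1) ∘ₗ N k) (fun j => Sum.elim (fun μ => fgrad n (liftEquiv (τ μ) ι)) (fun μ => bgrad n (liftEquiv (τ μ) ι)) j ∘ₗ (mulOp (fun p : X × ι => χtX k p.1) ∘ₗ N k))) (V k)))
      (fun y y' => ind (Sk k) y' * (θF * Real.exp (-(ρ₃ * g.dist y y')))))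
    (hFK' : ∀ k, HasMaj (BlockNorm.ofBlocks g (liftBlk (blk ∘ π) ι)) (BlockNorm.ofBlocks g (liftBlk (blk ∘ π) ι)) (commOp (F' k) (fun p : X' × ι => hX' k p.1) ∘ₗ (projO none ∘ₗ bgPropV (stack (mulOp (fun p : X' × ι => χtX' k p.1) ∘ₗ N' k) (fun j => Sum.elim (fun μ => fgrad n' (liftEquiv (τ' μ) ι)) (fun μ => bgrad n' (liftEquiv (τ' μ) ι)) j ∘ₗ (mulOp (fun p : X' × ι => χtX' k p.1) ∘ₗ N' k))) (V' k)))
      (fun y y' => ind (Sk k) y' * (θF * Real.exp (-(ρ₃ * g.dist y y')))))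
    (hFX : ∀ k, HasMaj (BlockNorm.ofBlocks g (liftBlk blk ι)) (BlockNorm.ofBlocks g (liftBlk blk ι)) (mulOp (fun p : X × ι => hX k p.1) ∘ₗ F k ∘ₗ (projO none ∘ₗ bgPropV (stack (mulOp (fun p : X × ι => χtX k p.1) ∘ₗ N k) (fun j => Sum.elim (fun μ => fgrad n (liftEquiv (τ μ) ι)) (fun μ => bgrad n (liftEquiv (τ μ) ι)) j ∘ₗ (mulOp (fun p : X × ι => χtX k p.1) ∘ₗ N k))) (V k)))
      (fun y y' => ind (Sk k) y * (εF * Real.exp (-(ρ₃ * g.dist y y')))))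
    (hFX' : ∀ k, HasMaj (BlockNorm.ofBlocks g (liftBlk (blk ∘ π) ι)) (BlockNorm.ofBlocks g (liftBlk (blk ∘ π) ι)) (mulOp (fun p : X' × ι => hX' k p.1) ∘ₗ F' k ∘ₗ (projO none ∘ₗ bgPropV (stack (mulOp (fun p : X' × ι => χtX' k p.1) ∘ₗ N' k) (fun j => Sum.elim (fun μ => fgrad n' (liftEquiv (τ' μ) ι)) (fun μ => bgrad n' (liftEquiv (τ' μ) ι)) j ∘ₗ (mulOp (fun p : X' × ι => χtX' k p.1) ∘ₗ N' k))) (V' k)))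
      (fun y y' => ind (Sk k) y * (εF * Real.exp (-(ρ₃ * g.dist y y')))))
    (hDFK : ∀ k, HasMaj (BlockNorm.ofBlocks g (liftBlk blk ι)) (BlockNorm.ofBlocks g (liftBlk (blk ∘ π) ι))
      (idef (pull (liftMap π ι)) (pull (liftMap π ι)) (commOp (F' k) (fun p : X' × ι => hX' k p.1) ∘ₗ (projO none ∘ₗ bgPropV (stack (mulOp (fun p : X' × ι => χtX' k p.1) ∘ₗ N' k) (fun j => Sum.elim (fun μ => fgrad n' (liftEquiv (τ' μ) ι)) (fun μ => bgrad n' (liftEquiv (τ' μ) ι)) j ∘ₗ (mulOp (fun p : X' × ι => χtX' k p.1) ∘ₗ N' k))) (V' k))) (commOp (F k) (fun p : X × ι => hX k p.1) ∘ₗ (projO none ∘ₗ bgPropV (stack (mulOp (fun p : X × ι => χtX k p.1) ∘ₗ N k) (fun j => Sum.elim (fun μ => fgrad n (liftEquiv (τ μ) ι)) (fun μ => bgrad n (liftEquiv (τ μ) ι)) j ∘ₗ (mulOp (fun p : X × ι => χtX k p.1) ∘ₗ N k))) (V k))))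
      (fun y y' => ind (Sk k) y' * (rFK * Real.exp (-(ρ₃ * g.dist y y')))))
    (hDFX : ∀ k, HasMaj (BlockNorm.ofBlocks g (liftBlk blk ι)) (BlockNorm.ofBlocks g (liftBlk (blk ∘ π) ι))
      (idef (pull (liftMap π ι)) (pull (liftMap π ι)) (mulOp (fun p : X' × ι => hX' k p.1) ∘ₗ F' k ∘ₗ (projO none ∘ₗ bgPropV (stack (mulOp (fun p : X' × ι => χtX' k p.1) ∘ₗ N' k) (fun j => Sum.elim (fun μ => fgrad n' (liftEquiv (τ' μ) ι)) (fun μ => bgrad n' (liftEquiv (τ' μ) ι)) j ∘ₗ (mulOp (fun p : X' × ι => χtX' k p.1) ∘ₗ N' k))) (V' k))) (mulOp (fun p : X × ι => hX k p.1) ∘ₗ F k ∘ₗ (projO none ∘ₗ bgPropV (stack (mulOp (fun p : X × ι => χtX k p.1) ∘ₗ N k) (fun j => Sum.elim (fun μ => fgrad n (liftEquiv (τ μ) ι)) (fun μ => bgrad n (liftEquiv (τ μ) ι)) j ∘ₗ (mulOp (fun p : X × ι => χtX k p.1) ∘ₗ N k))) (V k))))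
      (fun y y' => ind (Sk k) y * (rFE * Real.exp (-(ρ₃ * g.dist y y')))))
    (hq' : Nov * (((((Fintype.card J : ℝ) * (c₂ * ((β + (β₁ + ct * β)) * (1 - (β + (β₁ + ct * β)) * (R * cr) * cr)⁻¹) + 2 * (c₁ * ((β + (β₁ + ct * β)) * (1 - (β + (β₁ + ct * β)) * (R * cr) * cr)⁻¹))) + θW + cN * ((β + (β₁ + ct * β)) * (1 - (β + (β₁ + ct * β)) * (R * cr) * cr)⁻¹) * cr)
          + ((ℓ * (Real.exp 1 * ε)⁻¹ + 2 * (ω + ℓ * d₁)) * R * ((β + (β₁ + ct * β)) * (1 - (β + (β₁ + ct * β)) * (R * cr) * cr)⁻¹) * cr + R * c₁ * ((β + (β₁ + ct * β)) * (1 - (β + (β₁ + ct * β)) * (R * cr) * cr)⁻¹) * cr)) + θF) + ((ε₀ * (1 - (β + (β₁ + ct * β)) * (R * cr) * cr)⁻¹) + εF)) * cr < 1) (j : J ⊕ J) :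
    HasMaj (BlockNorm.ofBlocks g (liftBlk blk ι)) (BlockNorm.ofBlocks g (liftBlk (blk ∘ π) ι))
      (idef (pull (liftMap π ι)) (pull (liftMap π ι))
        (Sum.elim (fun μ => fgrad n' (liftEquiv (τ' μ) ι)) (fun μ => bgrad n' (liftEquiv (τ' μ) ι)) j ∘ₗ glueInv (parametrix (fun k (p : X' × ι) => hX' k p.1) (fun k => (projO none ∘ₗ bgPropV (stack (mulOp (fun p : X' × ι => χtX' k p.1) ∘ₗ N' k) (fun j => Sum.elim (fun μ => fgrad n' (liftEquiv (τ' μ) ι)) (fun μ => bgrad n' (liftEquiv (τ' μ) ι)) j ∘ₗ (mulOp (fun p : X' × ι => χtX' k p.1) ∘ₗ N' k))) (V' k))))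
          (remainder Δ' (fun k (p : X' × ι) => hX' k p.1) (fun k => (projO none ∘ₗ bgPropV (stack (mulOp (fun p : X' × ι => χtX' k p.1) ∘ₗ N' k) (fun j => Sum.elim (fun μ => fgrad n' (liftEquiv (τ' μ) ι)) (fun μ => bgrad n' (liftEquiv (τ' μ) ι)) j ∘ₗ (mulOp (fun p : X' × ι => χtX' k p.1) ∘ₗ N' k))) (V' k))) -
            ∑ k, (((((-(mulOp (fun p : X' × ι => hX' k p.1) ∘ₗ NL' ∘ₗ mulOp (1 - fun p : X' × ι => χtX' k p.1))) ∘ₗ N' k) ∘ₗ (LinearMap.id + (V' k ∘ₗ stack LinearMap.id (fun j => Sum.elim (fun μ => fgrad n' (liftEquiv (τ' μ) ι)) (fun μ => bgrad n' (liftEquiv (τ' μ) ι)) j)) ∘ₗ (projO none ∘ₗ bgPropV (stack (mulOp (fun p : X' × ι => χtX' k p.1) ∘ₗ N' k) (fun j => Sum.elim (fun μ => fgrad n' (liftEquiv (τ' μ) ι)) (fun μ => bgrad n' (liftEquiv (τ' μ) ι)) j ∘ₗ (mulOp (fun p : X' × ι => χtX' k p.1) ∘ₗ N' k))) (V' k)))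 + mulOp (fun p : X' × ι => hX' k p.1) ∘ₗ F' k ∘ₗ (projO none ∘ₗ bgPropV (stack (mulOp (fun p : X' × ι => χtX' k p.1) ∘ₗ N' k) (fun j => Sum.elim (fun μ => fgrad n' (liftEquiv (τ' μ) ι)) (fun μ => bgrad n' (liftEquiv (τ' μ) ι)) j ∘ₗ (mulOp (fun p : X' × ι => χtX' k p.1) ∘ₗ N' k))) (V' k))))) ∘ₗ mulOp (fun p : X' × ι => hX' k p.1)))
        (Sum.elim (fun μ => fgrad n (liftEquiv (τ μ) ι)) (fun μ => bgrad n (liftEquiv (τ μ) ι)) j ∘ₗ glueInv (parametrix (fun k (p : X × ι) => hX k p.1) (fun k => (projO none ∘ₗ bgPropV (stack (mulOp (fun p : X × ι => χtX k p.1) ∘ₗ N k) (fun j => Sum.elim (fun μ => fgrad n (liftEquiv (τ μ) ι)) (fun μ => bgrad n (liftEquiv (τ μ) ι)) j ∘ₗ (mulOp (fun p : X × ι => χtX k p.1) ∘ₗ N k))) (V k))))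
          (remainder Δ (fun k (p : X × ι) => hX k p.1) (fun k => (projO none ∘ₗ bgPropV (stack (mulOp (fun p : X × ι => χtX k p.1) ∘ₗ N k) (fun j => Sum.elim (fun μ => fgrad n (liftEquiv (τ μ) ι)) (fun μ => bgrad n (liftEquiv (τ μ) ι)) j ∘ₗ (mulOp (fun p : X × ι => χtX k p.1) ∘ₗ N k))) (V k))) -
            ∑ k, (((((-(mulOp (fun p : X × ι => hX k p.1) ∘ₗ NL ∘ₗ mulOp (1 - fun p : X × ι => χtX k p.1))) ∘ₗ N k) ∘ₗ (LinearMap.id + (V k ∘ₗ stack LinearMap.id (fun j => Sum.elim (fun μ => fgrad n (liftEquiv (τ μ) ι)) (fun μ => bgrad n (liftEquiv (τ μ) ι)) j)) ∘ₗ (projO none ∘ₗ bgPropV (stack (mulOp (fun p : X × ι => χtX k p.1) ∘ₗ N k) (fun j => Sum.elim (fun μ => fgrad n (liftEquiv (τ μ) ι)) (fun μ => bgrad n (liftEquiv (τ μ) ι)) j ∘ₗ (mulOp (fun p : X × ι => χtX k p.1) ∘ₗ N k))) (V k))) + mulOp (fun p : X × ι => hX k p.1) ∘ₗ F k ∘ₗ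 (projO none ∘ₗ bgPropV (stack (mulOp (fun p : X × ι => χtX k p.1) ∘ₗ N k) (fun j => Sum.elim (fun μ => fgrad n (liftEquiv (τ μ) ι)) (fun μ => bgrad n (liftEquiv (τ μ) ι)) j ∘ₗ (mulOp (fun p : X × ι => χtX k p.1) ∘ₗ N k))) (V k))))) ∘ₗ mulOp (fun p : X × ι => hX k p.1))))
      (fun y y' => (Nov * (1 * ((β + (β₁ + ct * β)) * (1 - (β + (β₁ + ct * β)) * (R * cr) * cr)⁻¹) + c₁ * ((β + (β₁ + ct * β)) * (1 - (β + (β₁ + ct * β)) * (R * cr) * cr)⁻¹)) * ((1 - Nov * ((((((Fintype.card J : ℝ) * (c₂ * ((β + (β₁ + ct * β)) * (1 - (β + (β₁ + ct * β)) * (R * cr) * cr)⁻¹) + 2 * (c₁ * ((β + (β₁ + ct * β)) * (1 - (β + (β₁ + ct * β)) * (R * cr) * cr)⁻¹))) + θW + cN * ((β + (β₁ + ct * β)) * (1 - (β + (β₁ + ct * β)) * (R * cr) * cr)⁻¹) * cr)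
          + ((ℓ * (Real.exp 1 * ε)⁻¹ + 2 * (ω + ℓ * d₁)) * R * ((β + (β₁ + ct * β)) * (1 - (β + (β₁ + ct * β)) * (R * cr) * cr)⁻¹) * cr + R * c₁ * ((β + (β₁ + ct * β)) * (1 - (β + (β₁ + ct * β)) * (R * cr) * cr)⁻¹) * cr)) + θF)) + (((ε₀ * (1 - (β + (β₁ + ct * β)) * (R * cr) * cr)⁻¹) + εF))) * cr)⁻¹ * ((1 - Nov * ((((((Fintype.card J : ℝ) * (c₂ * ((β + (β₁ + ct * β)) * (1 - (β + (β₁ + ct * β)) * (R * cr) * cr)⁻¹) + 2 * (c₁ * ((β + (β₁ + ct * β)) * (1 - (β + (β₁ + ct * β)) * (R * cr) * cr)⁻¹))) + θW + cN * ((β + (β₁ + ct * β)) * (1 - (β + (β₁ + ct * β)) * (R * cr) * cr)⁻¹) * cr)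
          + ((ℓ * (Real.exp 1 * ε)⁻¹ + 2 * (ω + ℓ * d₁)) * R * ((β + (β₁ + ct * β)) * (1 - (β + (β₁ + ct * β)) * (R * cr) * cr)⁻¹) * cr + R * c₁ * ((β + (β₁ + ct * β)) * (1 - (β + (β₁ + ct * β)) * (R * cr) * cr)⁻¹) * cr)) + θF)) + (((ε₀ * (1 - (β + (β₁ + ct * β)) * (R * cr) * cr)⁻¹) + εF))) * cr)⁻¹ * (Nov * ((((((Fintype.card J : ℝ) * (c₂ * ((β + (β₁ + ct * β)) * (1 - (β + (β₁ + ct * β)) * (R * cr) * cr)⁻¹) + 2 * (c₁ * ((β + (β₁ + ct * β)) * (1 - (β + (β₁ + ct * β)) * (R * cr) * cr)⁻¹))) + θW + cN * ((β + (β₁ + ct * β)) * (1 - (β + (β₁ + ct * β)) * (R * cr) * cr)⁻¹) * cr)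
          + ((ℓ * (Real.exp 1 * ε)⁻¹ + 2 * (ω + ℓ * d₁)) * R * ((β + (β₁ + ct * β)) * (1 - (β + (β₁ + ct * β)) * (R * cr) * cr)⁻¹) * cr + R * c₁ * ((β + (β₁ + ct * β)) * (1 - (β + (β₁ + ct * β)) * (R * cr) * cr)⁻¹) * cr)) + θF)) * oo + ((((((Fintype.card J * (c₂ * ((((m₀ + oχ * β) + (m₁ + oχ₁ * β₁ + ct * m₀ + oχ₂ * β)) * cr + 1 * (((m₀ + oχ * β) + (m₁ + oχ₁ * β₁ + ct * m₀ + oχ₂ * β)) * cr) * (R * ((β + (β₁ + ct * β)) * (1 - (β + (β₁ + ct * β)) * (R * cr) * cr)⁻¹) * cr) + (β + (β₁ + ct * β)) * o * cr * ((β + (β₁ + ct * β)) * (1 - (β + (β₁ + ct * β)) * (R * cr) * cr)⁻¹) * cr) * (1 - 1 * ((β + (β₁ + ct * β)) * (R * cr) * cr))⁻¹)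
              + o₂ * ((β + (β₁ + ct * β)) * (1 - (β + (β₁ + ct * β)) * (R * cr) * cr)⁻¹)
              + 2 * (c₁ * ((((m₀ + oχ * β) + (m₁ + oχ₁ * β₁ + ct * m₀ + oχ₂ * β)) * cr + 1 * (((m₀ + oχ * β) + (m₁ + oχ₁ * β₁ + ct * m₀ + oχ₂ * β)) * cr) * (R * ((β + (β₁ + ct * β)) * (1 - (β + (β₁ + ct * β)) * (R * cr) * cr)⁻¹) * cr) + (β + (β₁ + ct * β)) * o * cr * ((β + (β₁ + ct * β)) * (1 - (β + (β₁ + ct * β)) * (R * cr) * cr)⁻¹) * cr) * (1 - 1 * ((β + (β₁ + ct * β)) * (R * cr) * cr))⁻¹)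
                + o₁ * ((β + (β₁ + ct * β)) * (1 - (β + (β₁ + ct * β)) * (R * cr) * cr)⁻¹))) + rW)
          + (cN * ((((m₀ + oχ * β) + (m₁ + oχ₁ * β₁ + ct * m₀ + oχ₂ * β)) * cr + 1 * (((m₀ + oχ * β) + (m₁ + oχ₁ * β₁ + ct * m₀ + oχ₂ * β)) * cr) * (R * ((β + (β₁ + ct * β)) * (1 - (β + (β₁ + ct * β)) * (R * cr) * cr)⁻¹) * cr) + (β + (β₁ + ct * β)) * o * cr * ((β + (β₁ + ct * β)) * (1 - (β + (β₁ + ct * β)) * (R * cr) * cr)⁻¹) * cr) * (1 - 1 * ((β + (β₁ + ct * β)) * (R * cr) * cr))⁻¹) * cr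
              + rN * ((β + (β₁ + ct * β)) * (1 - (β + (β₁ + ct * β)) * (R * cr) * cr)⁻¹) * cr)
          + ((((ℓ * (Real.exp 1 * ε)⁻¹ + 2 * (ω + ℓ * d₁)) * R)
                * ((((m₀ + oχ * β) + (m₁ + oχ₁ * β₁ + ct * m₀ + oχ₂ * β)) * cr + 1 * (((m₀ + oχ * β) + (m₁ + oχ₁ * β₁ + ct * m₀ + oχ₂ * β)) * cr) * (R * ((β + (β₁ + ct * β)) * (1 - (β + (β₁ + ct * β)) * (R * cr) * cr)⁻¹) * cr) + (β + (β₁ + ct * β)) * o * cr * ((β + (β₁ + ct * β)) * (1 - (β + (β₁ + ct * β)) * (R * cr) * cr)⁻¹) * cr) * (1 - 1 * ((β + (β₁ + ct * β)) * (R * cr) * cr))⁻¹)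
              + ((ℓ * (Real.exp 1 * ε)⁻¹ + 2 * (ω + ℓ * d₁)) * o + 2 * R * (oo + c₁ / n' + c₁ / n))
                * ((β + (β₁ + ct * β)) * (1 - (β + (β₁ + ct * β)) * (R * cr) * cr)⁻¹)
              + R * (c₁ * ((((m₀ + oχ * β) + (m₁ + oχ₁ * β₁ + ct * m₀ + oχ₂ * β)) * cr + 1 * (((m₀ + oχ * β) + (m₁ + oχ₁ * β₁ + ct * m₀ + oχ₂ * β)) * cr) * (R * ((β + (β₁ + ct * β)) * (1 - (β + (β₁ + ct * β)) * (R * cr) * cr)⁻¹) * cr) + (β + (β₁ + ct * β)) * o * cr * ((β + (β₁ + ct * β)) * (1 - (β + (β₁ + ct * β)) * (R * cr) * cr)⁻¹) * cr) * (1 - 1 * ((β + (β₁ + ct * β)) * (R * cr) * cr))⁻¹)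
                + o₁ * ((β + (β₁ + ct * β)) * (1 - (β + (β₁ + ct * β)) * (R * cr) * cr)⁻¹))
              + o * c₁ * ((β + (β₁ + ct * β)) * (1 - (β + (β₁ + ct * β)) * (R * cr) * cr)⁻¹)) * cr)))) + rFK)) + ((((ε₀ * (1 - (β + (β₁ + ct * β)) * (R * cr) * cr)⁻¹) + εF)) * oo + ((((ε₀ * (R * ((((m₀ + oχ * β) + (m₁ + oχ₁ * β₁ + ct * m₀ + oχ₂ * β)) * cr + 1 * (((m₀ + oχ * β) + (m₁ + oχ₁ * β₁ + ct * m₀ + oχ₂ * β)) * cr) * (R * ((β + (β₁ + ct * β)) * (1 - (β + (β₁ + ct * β)) * (R * cr) * cr)⁻¹) * cr) + (β + (β₁ + ct * β)) * o * cr * ((β + (β₁ + ct * β)) * (1 - (β + (β₁ + ct * β)) * (R * cr) * cr)⁻¹) * cr) * (1 - 1 * ((β + (β₁ + ct * β)) * (R * cr) * cr))⁻¹) + o * ((β + (β₁ + ct * β)) * (1 - (β + (β₁ + ct * β)) * (R * cr) * cr)⁻¹)) * cr * cr + rF * (1 + R * ((β + (β₁ + ct * β)) * (1 - (β + (β₁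 + ct * β)) * (R * cr) * cr)⁻¹) * cr * cr))) + rFE))))) * cr) * cr) * cr +
        Nov * ((1 * ((β + (β₁ + ct * β)) * (1 - (β + (β₁ + ct * β)) * (R * cr) * cr)⁻¹) * oo + 1 * ((((m₀ + oχ * β) + (m₁ + oχ₁ * β₁ + ct * m₀ + oχ₂ * β)) * cr + 1 * (((m₀ + oχ * β) + (m₁ + oχ₁ * β₁ + ct * m₀ + oχ₂ * β)) * cr) * (R * ((β + (β₁ + ct * β)) * (1 - (β + (β₁ + ct * β)) * (R * cr) * cr)⁻¹) * cr) + (β + (β₁ + ct * β)) * o * cr * ((β + (β₁ + ct * β)) * (1 - (β + (β₁ + ct * β)) * (R * cr) * cr)⁻¹) * cr) * (1 - 1 * ((β + (β₁ + ct * β)) * (R * cr) * cr))⁻¹) * 1 + (oo + c₁ / n' + c₁ / n) * ((β + (β₁ + ct * β)) * (1 - (β + (β₁ + ct * β)) * (R * cr) * cr)⁻¹) * 1) + (c₁ * ((β + (β₁ + ct * β)) * (1 - (β + (β₁ + ct * β)) * (R * cr) * cr)⁻¹) * oo + c₁ * ((((m₀ + oχ * β) + (m₁ + oχ₁ * β₁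 + ct * m₀ + oχ₂ * β)) * cr + 1 * (((m₀ + oχ * β) + (m₁ + oχ₁ * β₁ + ct * m₀ + oχ₂ * β)) * cr) * (R * ((β + (β₁ + ct * β)) * (1 - (β + (β₁ + ct * β)) * (R * cr) * cr)⁻¹) * cr) + (β + (β₁ + ct * β)) * o * cr * ((β + (β₁ + ct * β)) * (1 - (β + (β₁ + ct * β)) * (R * cr) * cr)⁻¹) * cr) * (1 - 1 * ((β + (β₁ + ct * β)) * (R * cr) * cr))⁻¹) * 1 + o₁ * ((β + (β₁ + ct * β)) * (1 - (β + (β₁ + ct * β)) * (R * cr) * cr)⁻¹) * 1)) * (1 - Nov * ((((((Fintype.card J : ℝ) * (c₂ * ((β + (β₁ + ct * β)) * (1 - (β + (β₁ + ct * β)) * (R * cr) * cr)⁻¹) + 2 * (c₁ * ((β + (β₁ + ct * β)) * (1 - (β + (β₁ + ct * β)) * (R * cr) * cr)⁻¹))) + θW + cN * ((β + (β₁ + ct * β)) * (1 - (β + (β₁ + ct * β)) * (R * cr) * cr)⁻¹) * cr)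
          + ((ℓ * (Real.exp 1 * ε)⁻¹ + 2 * (ω + ℓ * d₁)) * R * ((β + (β₁ + ct * β)) * (1 - (β + (β₁ + ct * β)) * (R * cr) * cr)⁻¹) * cr + R * c₁ * ((β + (β₁ + ct * β)) * (1 - (β + (β₁ + ct * β)) * (R * cr) * cr)⁻¹) * cr)) + θF)) + (((ε₀ * (1 - (β + (β₁ + ct * β)) * (R * cr) * cr)⁻¹) + εF))) * cr)⁻¹ * cr) *
        Real.exp (-((ρ₃ - 2 * σ) * g.dist y y'))) := by
  obtain ⟨hβb, hmb, hB, hAD, hθ, hε', hrE⟩ := gluedDefect_letters_nonneg (J := J) hβ hβ₁ hct hm₀ hm₁ hoχ hoχ₁ hoχ₂ hR ho hε hc₁ hc₂ hθW hcN hℓ hω hd₁ hε₀ hrF hcr hq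
  have hr : 0 ≤ (((Fintype.card J * (c₂ * ((((m₀ + oχ * β) + (m₁ + oχ₁ * β₁ + ct * m₀ + oχ₂ * β)) * cr + 1 * (((m₀ + oχ * β) + (m₁ + oχ₁ * β₁ + ct * m₀ + oχ₂ * β)) * cr) * (R * ((β + (β₁ + ct * β)) * (1 - (β + (β₁ + ct * β)) * (R * cr) * cr)⁻¹) * cr) + (β + (β₁ + ct * β)) * o * cr * ((β + (β₁ + ct * β)) * (1 - (β + (β₁ + ct * β)) * (R * cr) * cr)⁻¹) * cr) * (1 - 1 * ((β + (β₁ + ct * β)) * (R * cr) * cr))⁻¹)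
              + o₂ * ((β + (β₁ + ct * β)) * (1 - (β + (β₁ + ct * β)) * (R * cr) * cr)⁻¹)
              + 2 * (c₁ * ((((m₀ + oχ * β) + (m₁ + oχ₁ * β₁ + ct * m₀ + oχ₂ * β)) * cr + 1 * (((m₀ + oχ * β) + (m₁ + oχ₁ * β₁ + ct * m₀ + oχ₂ * β)) * cr) * (R * ((β + (β₁ + ct * β)) * (1 - (β + (β₁ + ct * β)) * (R * cr) * cr)⁻¹) * cr) + (β + (β₁ + ct * β)) * o * cr * ((β + (β₁ + ct * β)) * (1 - (β + (β₁ + ct * β)) * (R * cr) * cr)⁻¹) * cr) * (1 - 1 * ((β + (β₁ + ct * β)) * (R * cr) * cr))⁻¹)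
                + o₁ * ((β + (β₁ + ct * β)) * (1 - (β + (β₁ + ct * β)) * (R * cr) * cr)⁻¹))) + rW)
          + (cN * ((((m₀ + oχ * β) + (m₁ + oχ₁ * β₁ + ct * m₀ + oχ₂ * β)) * cr + 1 * (((m₀ + oχ * β) + (m₁ + oχ₁ * β₁ + ct * m₀ + oχ₂ * β)) * cr) * (R * ((β + (β₁ + ct * β)) * (1 - (β + (β₁ + ct * β)) * (R * cr) * cr)⁻¹) * cr) + (β + (β₁ + ct * β)) * o * cr * ((β + (β₁ + ct * β)) * (1 - (β + (β₁ + ct * β)) * (R * cr) * cr)⁻¹) * cr) * (1 - 1 * ((β + (β₁ + ct * β)) * (R * cr) * cr))⁻¹) * cr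
              + rN * ((β + (β₁ + ct * β)) * (1 - (β + (β₁ + ct * β)) * (R * cr) * cr)⁻¹) * cr)
          + ((((ℓ * (Real.exp 1 * ε)⁻¹ + 2 * (ω + ℓ * d₁)) * R)
                * ((((m₀ + oχ * β) + (m₁ + oχ₁ * β₁ + ct * m₀ + oχ₂ * β)) * cr + 1 * (((m₀ + oχ * β) + (m₁ + oχ₁ * β₁ + ct * m₀ + oχ₂ * β)) * cr) * (R * ((β + (β₁ + ct * β)) * (1 - (β + (β₁ + ct * β)) * (R * cr) * cr)⁻¹) * cr) + (β + (β₁ + ct * β)) * o * cr * ((β + (β₁ + ct * β)) * (1 - (β + (β₁ + ct * β)) * (R * cr) * cr)⁻¹) * cr) * (1 - 1 * ((β + (β₁ + ct * β)) * (R * cr) * cr))⁻¹)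
              + ((ℓ * (Real.exp 1 * ε)⁻¹ + 2 * (ω + ℓ * d₁)) * o + 2 * R * (oo + c₁ / n' + c₁ / n))
                * ((β + (β₁ + ct * β)) * (1 - (β + (β₁ + ct * β)) * (R * cr) * cr)⁻¹)
              + R * (c₁ * ((((m₀ + oχ * β) + (m₁ + oχ₁ * β₁ + ct * m₀ + oχ₂ * β)) * cr + 1 * (((m₀ + oχ * β) + (m₁ + oχ₁ * β₁ + ct * m₀ + oχ₂ * β)) * cr) * (R * ((β + (β₁ + ct * β)) * (1 - (β + (β₁ + ct * β)) * (R * cr) * cr)⁻¹) * cr) + (β + (β₁ + ct * β)) * o * cr * ((β + (β₁ + ct * β)) * (1 - (β + (β₁ + ct * β)) * (R * cr) * cr)⁻¹) * cr) * (1 - 1 * ((β + (β₁ + ct * β)) * (R * cr) * cr))⁻¹)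
                + o₁ * ((β + (β₁ + ct * β)) * (1 - (β + (β₁ + ct * β)) * (R * cr) * cr)⁻¹))
              + o * c₁ * ((β + (β₁ + ct * β)) * (1 - (β + (β₁ + ct * β)) * (R * cr) * cr)⁻¹)) * cr))) :=
    add_nonneg (add_nonneg (gluedDefect_r0a_nonneg (J := J) hβ hβ₁ hct hm₀ hm₁ hoχ hoχ₁ hoχ₂ hR ho hc₁ hc₂ ho₁ ho₂ hrW hcr hq)
      (gluedDefect_r0b_nonneg hβ hβ₁ hct hm₀ hm₁ hoχ hoχ₁ hoχ₂ hR ho hcN hrN hcr hq))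
      (gluedDefect_r0c_nonneg n n' hβ hβ₁ hct hm₀ hm₁ hoχ hoχ₁ hoχ₂ hR ho hε hc₁ ho₁ hℓ hω hd₁ hoo hcr hn hn' hq)
  have hσρ₂ : σ ≤ ρ₂ := by linarith only [hσ, hσρ₃, hρ₃₂]
  have hρ₂V : ρ₂ + σ ≤ δV := by linarith only [hρ₂₁, hρ₁V]
  -- files 31∕34∕35: flat letters of both grids' smooth-cut cubes and jets, their defects; file 23: summable Neumann series and the pair letters; file 24: the pair defect
  have hG := fun k => hasMaj_smoothCut_flat blk (S := Sk k) hβ hβ₁ hct (hχt k) (hsub k) (hcut k)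
  have hD := fun k => hasMaj_jet_smoothCut_flat blk τ n (S := Sk k) hβ hβ₁ hct (hχt k) (hdχt k) (hdχtb k) (hs k) (hsb k) (hdd k) (hddb k) (hcut k) (hcutF k) (hcutB k)
  have hG' := fun k => hasMaj_smoothCut_flat (blk ∘ π) (S := Sk k) hβ hβ₁ hct (hχt' k) (hsub' k) (hcut' k)
  have hD' := fun k => hasMaj_jet_smoothCut_flat (blk ∘ π) τ' n' (S := Sk k) hβ hβ₁ hct (hχt' k) (hdχt' k) (hdχtb' k) (hs' k) (hsb' k) (hdd' k) (hddb' k) (hcut' k) (hcutF' k)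
    (hcutB' k)
  have hDG := fun k => hasMaj_idef_smoothCut_flat blk π (S := Sk k) (N := N k) (N' := N' k) hβ hβ₁ hct hm₀ hm₁ hoχ hoχ₁ hoχ₂ (hχt' k) (hfitχ k) (hsub k) (hsub' k) (hcut k) (hDcut k)
  have hDD := fun k => hasMaj_idef_jet_smoothCut_flat blk π τ τ' n n' (S := Sk k) (N := N k) (N' := N' k) hβ hβ₁ hct hm₀ hm₁ hoχ hoχ₁ hoχ₂ (hχt' k) (hdχt' k) (hdχtb' k) (hfit₁ k)
    (hfit₁b k) (hfit₂ k) (hfit₂b k) (hs k) (hsb k) (hdd k) (hddb k) (hs' k) (hsb' k) (hdd' k) (hddb' k) (hcut k) (hcutF k) (hcutB k) (hDcut k) (hDcutF k) (hDcutB k)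
  have hpair := fun k => hasMaj_dressedV_pair blk htri hd hrow hσ hβb hR hcr hσρ hρ₁V hρ₁G hρ₂ hρ₂₁ (hG k) (hD k) (hV k) hq
  have hpair' := fun k => hasMaj_dressedV_pair (blk ∘ π) htri hd hrow hσ hβb hR hcr hσρ hρ₁V hρ₁G hρ₂ hρ₂₁ (hG' k) (hD' k) (hV' k) hq
  have hDX := fun k => hasMaj_idef_dressedV_pair blk π htri hd hrow hσ hcr hβb hR ho hmb hσρ hρ₁V hρ₁G hρ₂ hρ₂₁ (hG k) (hD k) (hG' k) (hD' k) (hDG k) (hDD k) (hV k) (hV' k) (hDV k) hq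
  -- file 34: both grids' cut letters (`M_χX = X`), at the rate `ρ₃`
  have hGc := fun k => by
    have h34 := (hasMaj_smoothCutDressed_loc₂ blk τ n htri hd hrow hσ hβ hβ₁ hct hR hcr hσρ hρ₁V hρ₁G hρ₂ hρ₂₁ (hSχ k) (hSψ k) (hχt k) (hdχt k) (hdχtb k) (hsub k) (hχ k) (hs k) (hsb k) (hdd k) (hddb k) (hNψ k) (hcut k) (hcutF k) (hcutB k) (hV k) hq).mono fun y y' =>
      weight_mul_exp_rate_mono (mul_nonneg (ind_nonneg _ _) (ind_nonneg _ _)) hB hρ₃₂ (hd y y')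
    rw [← mulOp_comp_smoothCutDressed τ n (hχ k) (hNψ k) (hpair k).1] at h34
    exact h34
  have hGc' := fun k => by
    have h34 := (hasMaj_smoothCutDressed_loc₂ (blk ∘ π) τ' n' htri hd hrow hσ hβ hβ₁ hct hR hcr hσρ hρ₁V hρ₁G hρ₂ hρ₂₁ (hSχ' k) (hSψ' k) (hχt' k) (hdχt' k) (hdχtb' k) (hsub' k) (hχ' k) (hs' k) (hsb' k) (hdd' k) (hddb' k) (hNψ' k) (hcut' k) (hcutF' k) (hcutB' k) (hV' k) hq).mono fun y y' =>
      weight_mul_exp_rate_mono (mul_nonneg (ind_nonneg _ _) (ind_nonneg _ _)) hB hρ₃₂ (hd y y')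
    rw [← mulOp_comp_smoothCutDressed τ' n' (hχ' k) (hNψ' k) (hpair' k).1] at h34
    exact h34
  -- file 38: both grids' input-localized remainder rows (rate `ρ₃`)
  have hK := fun k => hasMaj_commOp_cubeOp_smoothCutDressed_in blk τ n htri hd hsymm hrow hσ hβ hβ₁ hct hR hcr hσρ hρ₁V hρ₁G hρ₂ hρ₂₁ hρ₃ hρ₃₂ hρ₃V hρ₃N hε hc₁ hc₂ hθW hcN hℓ hω hd₁ (hSχ k) (hSψ k) (hχt k) (hdχt k) (hdχtb k) (hsub k) (hχ k) (hs k) (hsb k) (hdd k) (hddb k) (hs2 k) (hsb2 k) (hdd2 k) (hddb2 k) (hNψ k) (hcut k) (hcutF k) (hcutB k) (hV k) hq (hh1 k) (hh1b k) (hh2 k) (hLip k) (hrh k) hstep (hW k) (hKN k)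
  have hK' := fun k => hasMaj_commOp_cubeOp_smoothCutDressed_in (blk ∘ π) τ' n' htri hd hsymm hrow hσ hβ hβ₁ hct hR hcr hσρ hρ₁V hρ₁G hρ₂ hρ₂₁ hρ₃ hρ₃₂ hρ₃V hρ₃N hε hc₁ hc₂ hθW hcN hℓ hω hd₁ (hSχ' k) (hSψ' k) (hχt' k) (hdχt' k) (hdχtb' k) (hsub' k) (hχ' k) (hs' k) (hsb' k) (hdd' k) (hddb' k) (hs2' k) (hsb2' k) (hdd2' k) (hddb2' k) (hNψ' k) (hcut' k) (hcutF' k) (hcutB' k) (hV' k) hq (hh1' k) (hh1b' k) (hh2' k) (hLip k) (hrh' k) hstep' (hW' k) (hKN' k)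
  -- file 33: both grids' locality defects' letters (rate `ρ₃`)
  have hE := fun k => (hasMaj_dressedTail_out blk htri hd hrow hσ hβb hR hε₀ hcr hσρ hρ₁V hρ₁G hρ₂ hρ₂₁ hρ₂T (fun _ => rfl) (hG k) (hD k) (hV k) hq (hT k)).mono
    fun y y' => weight_mul_exp_rate_mono (ind_nonneg _ _) hε' hρ₃₂ (hd y y')
  have hE' := fun k => (hasMaj_dressedTail_out (blk ∘ π) htri hd hrow hσ hβb hR hε₀ hcr hσρ hρ₁V hρ₁G hρ₂ hρ₂₁ hρ₂T (fun _ => rfl) (hG' k) (hD' k) (hV' k) hq (hT' k)).mono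
    fun y y' => weight_mul_exp_rate_mono (ind_nonneg _ _) hε' hρ₃₂ (hd y y')
  -- file 35: the two-grid defect of the cut letters (rate `ρ₃`)
  have hDGc := fun k => by
    have h35 := (hasMaj_idef_smoothCutDressed_loc₂ blk π τ τ' n n' htri hd hrow hσ hcr hβ hβ₁ hct hm₀ hm₁ hoχ hoχ₁ hoχ₂ hR ho hσρ hρ₁V hρ₁G hρ₂ hρ₂₁ (hSχ k) (hSψ k) (hSχ' k) (hSψ' k) (hχt k) (hdχt k) (hdχtb k) (hsub k) (hχ k) (hs k) (hsb k) (hdd k) (hddb k) (hNψ k) (hχt' k) (hdχt' k) (hdχtb' k) (hsub' k) (hχ' k) (hs' k) (hsb' k) (hdd' k) (hddb' k) (hNψ' k) (hfitχ k) (hfit₁ k) (hfit₁b k) (hfit₂ k) (hfit₂b k) (hcut k) (hcutF k) (hcutB k) (hcut' k) (hcutF' k) (hcutB' k) (hDcut k) (hDcutF k) (hDcutB k) (hV k) (hV' k) (hDV k) hq).mono fun y y' =>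
      weight_mul_exp_rate_mono (mul_nonneg (ind_nonneg _ _) (ind_nonneg _ _)) hAD hρ₃₂ (hd y y')
    rw [← mulOp_comp_smoothCutDressed τ n (hχ k) (hNψ k) (hpair k).1, ← mulOp_comp_smoothCutDressed τ' n' (hχ' k) (hNψ' k) (hpair' k).1] at h35
    exact h35
  -- file 39: the two-grid defect of the remainder rows (rate `ρ₃`)
  have hDK := fun k => hasMaj_idef_commOp_cubeOp_smoothCutDressed_in blk π τ τ' n n' htri hd hsymm hrow hσ hcr hβ hβ₁ hct hm₀ hm₁ hoχ hoχ₁ hoχ₂ hR ho hσρ hρ₁V hρ₁G hρ₂ hρ₂₁ hρ₃ hρ₃₂ hρ₃V hρ₃N hε hc₁ hc₂ ho₁ ho₂ hrW hcN hrN hℓ hω hd₁ hoo hn hn' (hSχ k) (hSψ k) (hSχ' k) (hSψ' k) (hχt k) (hdχt k) (hdχtb k) (hsub k) (hχ k) (hs k) (hsb k) (hdd k) (hddb k) (hNψ k) (hχt' k) (hdχt' k) (hdχtb' k) (hsub' k) (hχ' k) (hs' k) (hsb' k) (hdd' k) (hddb' k) (hNψ' k) (hfitχ k) (hfit₁ k)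 (hfit₁b k) (hfit₂ k) (hfit₂b k) (hcut k) (hcutF k) (hcutB k) (hcut' k) (hcutF' k) (hcutB' k) (hDcut k) (hDcutF k) (hDcutB k) (hs2 k) (hsb2 k) (hdd2 k) (hddb2 k) (hs2' k) (hsb2' k) (hdd2' k) (hddb2' k) (hV k) (hV' k) (hDV k) hq (hh1 k) (hh1b k) (hh1' k) (hh1b' k) (hh2' k) (hf1 k) (hf1b k) (hf2 k) (hLip k) (hrh k) (hrh' k) (hfh k) hstep hstep' (hDW k) (hKN' k) (hDKN k)
  -- file 33: the two-grid defect of the locality defects (rate `ρ₃`)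
  have hDE := fun k => (hasMaj_idef_dressedTail_out blk π htri hd hrow hσ hcr hR ho hε₀ hrF hB hAD hσρ₂ hρ₂V hρ₂T (fun _ => rfl) (fun _ => rfl) (hpair k).1 (hpair' k).1 (hT' k)
    (hDT k) (hpair k).2 (hDX k) (hV k) (hV' k) (hDV k)).mono fun y y' => weight_mul_exp_rate_mono (ind_nonneg _ _) hrE hρ₃₂ (hd y y')
  -- the far defects `F_k`, `F′_k` of the local-gauge operators: their rows join the remainder rows and the locality defects, their η-defects the defect rows
  have eC : ∀ (A B G : (X × ι → ℝ) →ₗ[ℝ] (X × ι → ℝ)) (a : X × ι → ℝ), commOp (A + B) a ∘ₗ G = commOp A a ∘ₗ G + commOp B a ∘ₗ G := fun A B G a => by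
    simp only [commOp, LinearMap.add_comp, LinearMap.comp_add, LinearMap.sub_comp]; abel
  have eC' : ∀ (A B G : (X' × ι → ℝ) →ₗ[ℝ] (X' × ι → ℝ)) (a : X' × ι → ℝ), commOp (A + B) a ∘ₗ G = commOp A a ∘ₗ G + commOp B a ∘ₗ G := fun A B G a => by
    simp only [commOp, LinearMap.add_comp, LinearMap.comp_add, LinearMap.sub_comp]; abel
  have hKt : ∀ k, HasMaj (BlockNorm.ofBlocks g (liftBlk blk ι)) (BlockNorm.ofBlocks g (liftBlk blk ι)) (commOp Δ (fun p : X × ι => hX k p.1) ∘ₗ (projO none ∘ₗ bgPropV (stack (mulOp (fun p : X × ι => χtX k p.1) ∘ₗ N k) (fun j => Sum.elim (fun μ => fgrad n (liftEquiv (τ μ) ι)) (fun μ => bgrad n (liftEquiv (τ μ) ι)) j ∘ₗ (mulOp (fun p : X × ι => χtX k p.1) ∘ₗ N k))) (V k)))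
      (fun y y' => ind (Sk k) y' * (((((Fintype.card J : ℝ) * (c₂ * ((β + (β₁ + ct * β)) * (1 - (β + (β₁ + ct * β)) * (R * cr) * cr)⁻¹) + 2 * (c₁ * ((β + (β₁ + ct * β)) * (1 - (β + (β₁ + ct * β)) * (R * cr) * cr)⁻¹))) + θW + cN * ((β + (β₁ + ct * β)) * (1 - (β + (β₁ + ct * β)) * (R * cr) * cr)⁻¹) * cr)
          + ((ℓ * (Real.exp 1 * ε)⁻¹ + 2 * (ω + ℓ * d₁)) * R * ((β + (β₁ + ct * β)) * (1 - (β + (β₁ + ct * β)) * (R * cr) * cr)⁻¹) * cr + R * c₁ * ((β + (β₁ + ct * β)) * (1 - (β + (β₁ + ct * β)) * (R * cr) * cr)⁻¹) * cr)) + θF) * Real.exp (-(ρ₃ * g.dist y y')))) := fun k => by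
    rw [hcov k, eC]
    exact ((hK k).add (hFK k)).mono fun y y' => le_of_eq (by ring)
  have hKt' : ∀ k, HasMaj (BlockNorm.ofBlocks g (liftBlk (blk ∘ π) ι)) (BlockNorm.ofBlocks g (liftBlk (blk ∘ π) ι)) (commOp Δ' (fun p : X' × ι => hX' k p.1) ∘ₗ (projO none ∘ₗ bgPropV (stack (mulOp (fun p : X' × ι => χtX' k p.1) ∘ₗ N' k) (fun j => Sum.elim (fun μ => fgrad n' (liftEquiv (τ' μ) ι)) (fun μ => bgrad n' (liftEquiv (τ' μ) ι)) j ∘ₗ (mulOp (fun p : X' × ι => χtX' k p.1) ∘ₗ N' k))) (V' k)))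
      (fun y y' => ind (Sk k) y' * (((((Fintype.card J : ℝ) * (c₂ * ((β + (β₁ + ct * β)) * (1 - (β + (β₁ + ct * β)) * (R * cr) * cr)⁻¹) + 2 * (c₁ * ((β + (β₁ + ct * β)) * (1 - (β + (β₁ + ct * β)) * (R * cr) * cr)⁻¹))) + θW + cN * ((β + (β₁ + ct * β)) * (1 - (β + (β₁ + ct * β)) * (R * cr) * cr)⁻¹) * cr)
          + ((ℓ * (Real.exp 1 * ε)⁻¹ + 2 * (ω + ℓ * d₁)) * R * ((β + (β₁ + ct * β)) * (1 - (β + (β₁ + ct * β)) * (R * cr) * cr)⁻¹) * cr + R * c₁ * ((β + (β₁ + ct * β)) * (1 - (β + (β₁ + ct * β)) * (R * cr) * cr)⁻¹) * cr)) + θF) * Real.exp (-(ρ₃ * g.dist y y')))) := fun k => by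
    rw [hcov' k, eC']
    exact ((hK' k).add (hFK' k)).mono fun y y' => le_of_eq (by ring)
  have hEt : ∀ k, HasMaj (BlockNorm.ofBlocks g (liftBlk blk ι)) (BlockNorm.ofBlocks g (liftBlk blk ι)) (((-(mulOp (fun p : X × ι => hX k p.1) ∘ₗ NL ∘ₗ mulOp (1 - fun p : X × ι => χtX k p.1))) ∘ₗ N k) ∘ₗ (LinearMap.id + (V k ∘ₗ stack LinearMap.id (fun j => Sum.elim (fun μ => fgrad n (liftEquiv (τ μ) ι)) (fun μ => bgrad n (liftEquiv (τ μ) ι)) j)) ∘ₗ (projO none ∘ₗ bgPropV (stack (mulOp (fun p : X × ι => χtX k p.1) ∘ₗ N k) (fun j => Sum.elim (fun μ => fgrad n (liftEquiv (τ μ) ι)) (fun μ => bgrad n (liftEquiv (τ μ) ι)) j ∘ₗ (mulOp (fun p : X × ι => χtX k p.1) ∘ₗ N k))) (V k))) + mulOp (fun p : X × ι => hX k p.1) ∘ₗ F k ∘ₗ (projO none ∘ₗ bgPropV (stack (mulOp (fun p : X × ι => χtX k p.1) ∘ₗ N k) (fun j => Sum.elim (fun μ => fgrad n (liftEquiv (τ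 μ) ι)) (fun μ => bgrad n (liftEquiv (τ μ) ι)) j ∘ₗ (mulOp (fun p : X × ι => χtX k p.1) ∘ₗ N k))) (V k)))
      (fun y y' => ind (Sk k) y * (((ε₀ * (1 - (β + (β₁ + ct * β)) * (R * cr) * cr)⁻¹) + εF) * Real.exp (-(ρ₃ * g.dist y y')))) := fun k => ((hE k).add (hFX k)).mono fun y y' => le_of_eq (by ring)
  have hEt' : ∀ k, HasMaj (BlockNorm.ofBlocks g (liftBlk (blk ∘ π) ι)) (BlockNorm.ofBlocks g (liftBlk (blk ∘ π) ι)) (((-(mulOp (fun p : X' × ι => hX' k p.1) ∘ₗ NL' ∘ₗ mulOp (1 - fun p : X' × ι => χtX' k p.1))) ∘ₗ N' k) ∘ₗ (LinearMap.id + (V' k ∘ₗ stack LinearMap.id (fun j => Sum.elim (fun μ => fgrad n' (liftEquiv (τ' μ) ι)) (fun μ => bgrad n' (liftEquiv (τ' μ) ι)) j)) ∘ₗ (projO none ∘ₗ bgPropV (stack (mulOp (fun p : X' × ι => χtX' k p.1) ∘ₗ N' k) (fun j => Sum.elim (fun μ => fgrad n' (liftEquiv (τ' μ) ι)) (fun μ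 => bgrad n' (liftEquiv (τ' μ) ι)) j ∘ₗ (mulOp (fun p : X' × ι => χtX' k p.1) ∘ₗ N' k))) (V' k))) + mulOp (fun p : X' × ι => hX' k p.1) ∘ₗ F' k ∘ₗ (projO none ∘ₗ bgPropV (stack (mulOp (fun p : X' × ι => χtX' k p.1) ∘ₗ N' k) (fun j => Sum.elim (fun μ => fgrad n' (liftEquiv (τ' μ) ι)) (fun μ => bgrad n' (liftEquiv (τ' μ) ι)) j ∘ₗ (mulOp (fun p : X' × ι => χtX' k p.1) ∘ₗ N' k))) (V' k)))
      (fun y y' => ind (Sk k) y * (((ε₀ * (1 - (β + (β₁ + ct * β)) * (R * cr) * cr)⁻¹) + εF) * Real.exp (-(ρ₃ * g.dist y y')))) := fun k => ((hE' k).add (hFX' k)).mono fun y y' => le_of_eq (by ring)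
  have hDKt : ∀ k, HasMaj (BlockNorm.ofBlocks g (liftBlk blk ι)) (BlockNorm.ofBlocks g (liftBlk (blk ∘ π) ι))
      (idef (pull (liftMap π ι)) (pull (liftMap π ι)) (commOp Δ' (fun p : X' × ι => hX' k p.1) ∘ₗ (projO none ∘ₗ bgPropV (stack (mulOp (fun p : X' × ι => χtX' k p.1) ∘ₗ N' k) (fun j => Sum.elim (fun μ => fgrad n' (liftEquiv (τ' μ) ι)) (fun μ => bgrad n' (liftEquiv (τ' μ) ι)) j ∘ₗ (mulOp (fun p : X' × ι => χtX' k p.1) ∘ₗ N' k))) (V' k)))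
        (commOp Δ (fun p : X × ι => hX k p.1) ∘ₗ (projO none ∘ₗ bgPropV (stack (mulOp (fun p : X × ι => χtX k p.1) ∘ₗ N k) (fun j => Sum.elim (fun μ => fgrad n (liftEquiv (τ μ) ι)) (fun μ => bgrad n (liftEquiv (τ μ) ι)) j ∘ₗ (mulOp (fun p : X × ι => χtX k p.1) ∘ₗ N k))) (V k))))
      (fun y y' => ind (Sk k) y' * ((((((Fintype.card J * (c₂ * ((((m₀ + oχ * β) + (m₁ + oχ₁ * β₁ + ct * m₀ + oχ₂ * β)) * cr + 1 * (((m₀ + oχ * β) + (m₁ + oχ₁ * β₁ + ct * m₀ + oχ₂ * β)) * cr) * (R * ((β + (β₁ + ct * β)) * (1 - (β + (β₁ + ct * β)) * (R * cr) * cr)⁻¹) * cr) + (β + (β₁ + ct * β)) * o * cr * ((β + (β₁ + ct * β)) * (1 - (β + (β₁ + ct * β)) * (R * cr) * cr)⁻¹) * cr) * (1 - 1 * ((β + (β₁ + ct * β)) * (R * cr) * cr))⁻¹)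
              + o₂ * ((β + (β₁ + ct * β)) * (1 - (β + (β₁ + ct * β)) * (R * cr) * cr)⁻¹)
              + 2 * (c₁ * ((((m₀ + oχ * β) + (m₁ + oχ₁ * β₁ + ct * m₀ + oχ₂ * β)) * cr + 1 * (((m₀ + oχ * β) + (m₁ + oχ₁ * β₁ + ct * m₀ + oχ₂ * β)) * cr) * (R * ((β + (β₁ + ct * β)) * (1 - (β + (β₁ + ct * β)) * (R * cr) * cr)⁻¹) * cr) + (β + (β₁ + ct * β)) * o * cr * ((β + (β₁ + ct * β)) * (1 - (β + (β₁ + ct * β)) * (R * cr) * cr)⁻¹) * cr) * (1 - 1 * ((β + (β₁ + ct * β)) * (R * cr) * cr))⁻¹)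
                + o₁ * ((β + (β₁ + ct * β)) * (1 - (β + (β₁ + ct * β)) * (R * cr) * cr)⁻¹))) + rW)
          + (cN * ((((m₀ + oχ * β) + (m₁ + oχ₁ * β₁ + ct * m₀ + oχ₂ * β)) * cr + 1 * (((m₀ + oχ * β) + (m₁ + oχ₁ * β₁ + ct * m₀ + oχ₂ * β)) * cr) * (R * ((β + (β₁ + ct * β)) * (1 - (β + (β₁ + ct * β)) * (R * cr) * cr)⁻¹) * cr) + (β + (β₁ + ct * β)) * o * cr * ((β + (β₁ + ct * β)) * (1 - (β + (β₁ + ct * β)) * (R * cr) * cr)⁻¹) * cr) * (1 - 1 * ((β + (β₁ + ct * β)) * (R * cr) * cr))⁻¹) * cr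
              + rN * ((β + (β₁ + ct * β)) * (1 - (β + (β₁ + ct * β)) * (R * cr) * cr)⁻¹) * cr)
          + ((((ℓ * (Real.exp 1 * ε)⁻¹ + 2 * (ω + ℓ * d₁)) * R)
                * ((((m₀ + oχ * β) + (m₁ + oχ₁ * β₁ + ct * m₀ + oχ₂ * β)) * cr + 1 * (((m₀ + oχ * β) + (m₁ + oχ₁ * β₁ + ct * m₀ + oχ₂ * β)) * cr) * (R * ((β + (β₁ + ct * β)) * (1 - (β + (β₁ + ct * β)) * (R * cr) * cr)⁻¹) * cr) + (β + (β₁ + ct * β)) * o * cr * ((β + (β₁ + ct * β)) * (1 - (β + (β₁ + ct * β)) * (R * cr) * cr)⁻¹) * cr) * (1 - 1 * ((β + (β₁ + ct * β)) * (R * cr) * cr))⁻¹)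
              + ((ℓ * (Real.exp 1 * ε)⁻¹ + 2 * (ω + ℓ * d₁)) * o + 2 * R * (oo + c₁ / n' + c₁ / n))
                * ((β + (β₁ + ct * β)) * (1 - (β + (β₁ + ct * β)) * (R * cr) * cr)⁻¹)
              + R * (c₁ * ((((m₀ + oχ * β) + (m₁ + oχ₁ * β₁ + ct * m₀ + oχ₂ * β)) * cr + 1 * (((m₀ + oχ * β) + (m₁ + oχ₁ * β₁ + ct * m₀ + oχ₂ * β)) * cr) * (R * ((β + (β₁ + ct * β)) * (1 - (β + (β₁ + ct * β)) * (R * cr) * cr)⁻¹) * cr) + (β + (β₁ + ct * β)) * o * cr * ((β + (β₁ + ct * β)) * (1 - (β + (β₁ + ct * β)) * (R * cr) * cr)⁻¹) * cr) * (1 - 1 * ((β + (β₁ + ct * β)) * (R * cr) * cr))⁻¹)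
                + o₁ * ((β + (β₁ + ct * β)) * (1 - (β + (β₁ + ct * β)) * (R * cr) * cr)⁻¹))
              + o * c₁ * ((β + (β₁ + ct * β)) * (1 - (β + (β₁ + ct * β)) * (R * cr) * cr)⁻¹)) * cr)))) + rFK) * Real.exp (-(ρ₃ * g.dist y y')))) := fun k => by
    rw [hcov k, hcov' k, eC, eC', idef_add]
    exact ((hDK k).add (hDFK k)).mono fun y y' => le_of_eq (by ring)
  have hDEt : ∀ k, HasMaj (BlockNorm.ofBlocks g (liftBlk blk ι)) (BlockNorm.ofBlocks g (liftBlk (blk ∘ π) ι))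
      (idef (pull (liftMap π ι)) (pull (liftMap π ι)) (((-(mulOp (fun p : X' × ι => hX' k p.1) ∘ₗ NL' ∘ₗ mulOp (1 - fun p : X' × ι => χtX' k p.1))) ∘ₗ N' k) ∘ₗ (LinearMap.id + (V' k ∘ₗ stack LinearMap.id (fun j => Sum.elim (fun μ => fgrad n' (liftEquiv (τ' μ) ι)) (fun μ => bgrad n' (liftEquiv (τ' μ) ι)) j)) ∘ₗ (projO none ∘ₗ bgPropV (stack (mulOp (fun p : X' × ι => χtX' k p.1) ∘ₗ N' k) (fun j => Sum.elim (fun μ => fgrad n' (liftEquiv (τ' μ) ι)) (fun μ => bgrad n' (liftEquiv (τ' μ) ι)) j ∘ₗ (mulOp (fun p : X' × ι => χtX' k p.1) ∘ₗ N' k))) (V' k))) + mulOp (fun p : X' × ι => hX' k p.1) ∘ₗ F' k ∘ₗ (projO none ∘ₗ bgPropV (stack (mulOp (fun p : X' × ι => χtX' k p.1) ∘ₗ N' k) (fun j => Sum.elim (fun μ => fgrad n' (liftEquiv (τ' μ) ι)) (fun μ => bgrad n' (liftEquiv (τ' μ) ι)) j ∘ₗ (mulOp (fun p : X' × ι =>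 χtX' k p.1) ∘ₗ N' k))) (V' k))) (((-(mulOp (fun p : X × ι => hX k p.1) ∘ₗ NL ∘ₗ mulOp (1 - fun p : X × ι => χtX k p.1))) ∘ₗ N k) ∘ₗ (LinearMap.id + (V k ∘ₗ stack LinearMap.id (fun j => Sum.elim (fun μ => fgrad n (liftEquiv (τ μ) ι)) (fun μ => bgrad n (liftEquiv (τ μ) ι)) j)) ∘ₗ (projO none ∘ₗ bgPropV (stack (mulOp (fun p : X × ι => χtX k p.1) ∘ₗ N k) (fun j => Sum.elim (fun μ => fgrad n (liftEquiv (τ μ) ι)) (fun μ => bgrad n (liftEquiv (τ μ) ι)) j ∘ₗ (mulOp (fun p : X × ι => χtX k p.1) ∘ₗ N k))) (V k))) + mulOp (fun p : X × ι => hX k p.1) ∘ₗ F k ∘ₗ (projO none ∘ₗ bgPropV (stack (mulOp (fun p : X × ι => χtX k p.1) ∘ₗ N k) (fun j => Sum.elim (fun μ => fgrad n (liftEquiv (τ μ) ι)) (fun μ => bgrad n (liftEquiv (τ μ) ι)) j ∘ₗ (mulOp (fun p : X × ι => χtX k p.1) ∘ₗ N k))) (V k))))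
      (fun y y' => ind (Sk k) y * ((((ε₀ * (R * ((((m₀ + oχ * β) + (m₁ + oχ₁ * β₁ + ct * m₀ + oχ₂ * β)) * cr + 1 * (((m₀ + oχ * β) + (m₁ + oχ₁ * β₁ + ct * m₀ + oχ₂ * β)) * cr) * (R * ((β + (β₁ + ct * β)) * (1 - (β + (β₁ + ct * β)) * (R * cr) * cr)⁻¹) * cr) + (β + (β₁ + ct * β)) * o * cr * ((β + (β₁ + ct * β)) * (1 - (β + (β₁ + ct * β)) * (R * cr) * cr)⁻¹) * cr) * (1 - 1 * ((β + (β₁ + ct * β)) * (R * cr) * cr))⁻¹) + o * ((β + (β₁ + ct * β)) * (1 - (β + (β₁ + ct * β)) * (R * cr) * cr)⁻¹)) * cr * cr + rF * (1 + R * ((β + (β₁ + ct * β)) * (1 - (β + (β₁ + ct * β)) * (R * cr) * cr)⁻¹) * cr * cr))) + rFE) * Real.exp (-(ρ₃ * g.dist y y')))) := fun k => by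
    rw [idef_add]
    exact ((hDE k).add (hDFX k)).mono fun y y' => le_of_eq (by ring)
  -- THE JET: lattice Leibniz of `∇^±_μ` through the partitions (both grids), the shifted partition's letters and fits, the fits of `∇h`
  have hleib : ∀ i, Sum.elim (fun μ => fgrad n (liftEquiv (τ μ) ι)) (fun μ => bgrad n (liftEquiv (τ μ) ι)) j ∘ₗ mulOp (fun p : X × ι => hX i p.1) = mulOp ((fun p : X × ι => hX i p.1) ∘ ⇑(Sum.elim (fun μ => liftEquiv (τ μ) ι) (fun μ => (liftEquiv (τ μ) ι).symm) j)) ∘ₗ Sum.elim (fun μ => fgrad n (liftEquiv (τ μ) ι)) (fun μ => bgrad n (liftEquiv (τ μ) ι)) j + mulOp ((Sum.elim (fun μ => fgrad n (liftEquiv (τ μ) ι)) (fun μ => bgrad n (liftEquiv (τ μ) ι)) j) (fun p : X × ι => hX i p.1)) :=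
    fun i => by cases j with | inl μ => exact fgrad_comp_mulOp n (liftEquiv (τ μ) ι) (fun p : X × ι => hX i p.1) | inr μ => exact bgrad_comp_mulOp n (liftEquiv (τ μ) ι) (fun p : X × ι => hX i p.1)
  have hleib' : ∀ i, Sum.elim (fun μ => fgrad n' (liftEquiv (τ' μ) ι)) (fun μ => bgrad n' (liftEquiv (τ' μ) ι)) j ∘ₗ mulOp (fun p : X' × ι => hX' i p.1) = mulOp ((fun p : X' × ι => hX' i p.1) ∘ ⇑(Sum.elim (fun μ => liftEquiv (τ' μ) ι) (fun μ => (liftEquiv (τ' μ) ι).symm) j)) ∘ₗ Sum.elim (fun μ => fgrad n' (liftEquiv (τ' μ) ι)) (fun μ => bgrad n' (liftEquiv (τ' μ) ι)) j + mulOp ((Sum.elim (fun μ => fgrad n' (liftEquiv (τ' μ) ι)) (fun μ => bgrad n' (liftEquiv (τ' μ) ι)) j) (fun p : X' × ι => hX' i p.1)) :=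
    fun i => by cases j with | inl μ => exact fgrad_comp_mulOp n' (liftEquiv (τ' μ) ι) (fun p : X' × ι => hX' i p.1) | inr μ => exact bgrad_comp_mulOp n' (liftEquiv (τ' μ) ι) (fun p : X' × ι => hX' i p.1)
  have hhs' : ∀ i (x' : X' × ι), |((fun p : X' × ι => hX' i p.1) ∘ ⇑(Sum.elim (fun μ => liftEquiv (τ' μ) ι) (fun μ => (liftEquiv (τ' μ) ι).symm) j)) x'| ≤ 1 := fun i x' => hhabs' i _
  have hdh' : ∀ i (x' : X' × ι), |(Sum.elim (fun μ => fgrad n' (liftEquiv (τ' μ) ι)) (fun μ => bgrad n' (liftEquiv (τ' μ) ι)) j) (fun p : X' × ι => hX' i p.1) x'| ≤ c₁ := fun i x' => by cases j with | inl μ => exact hh1' i μ x' | inr μ => exact hh1b' i μ x'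
  have hfits : ∀ i (x' : X' × ι), |((fun p : X' × ι => hX' i p.1) ∘ ⇑(Sum.elim (fun μ => liftEquiv (τ' μ) ι) (fun μ => (liftEquiv (τ' μ) ι).symm) j)) x' - ((fun p : X × ι => hX i p.1) ∘ ⇑(Sum.elim (fun μ => liftEquiv (τ μ) ι) (fun μ => (liftEquiv (τ μ) ι).symm) j)) (liftMap π ι x')| ≤ oo + c₁ / n' + c₁ / n :=
    fun i x' => by
    cases j with
    | inl μ =>
      have h1 := hh1' i μ x'; have h3 := hh1 i μ (liftMap π ι x'); simp only [fgrad_apply, Function.comp_apply, liftEquiv_apply, Sum.elim_inl] at h1 h3 ⊢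
      exact abs_shift_fit hn hn' h1 (hfh i x') h3
    | inr μ =>
      have h1 := hh1b' i μ x'; have h3 := hh1b i μ (liftMap π ι x'); simp only [bgrad_apply, Function.comp_apply, liftEquiv_symm_apply, Sum.elim_inr] at h1 h3 ⊢
      exact abs_shift_fit' hn hn' h1 (hfh i x') h3
  have hfitd : ∀ i (x' : X' × ι), |(Sum.elim (fun μ => fgrad n' (liftEquiv (τ' μ) ι)) (fun μ => bgrad n' (liftEquiv (τ' μ) ι)) j) (fun p : X' × ι => hX' i p.1) x' - (Sum.elim (fun μ => fgrad n (liftEquiv (τ μ) ι)) (fun μ => bgrad n (liftEquiv (τ μ) ι)) j) (fun p : X × ι => hX i p.1) (liftMap π ι x')| ≤ o₁ :=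
    fun i x' => by cases j with | inl μ => exact hf1 i μ x' | inr μ => exact hf1b i μ x'
  have hos : 0 ≤ oo + c₁ / n' + c₁ / n := by positivity
  -- file 34: the one-grid JET rows of the dressed cubes (`∇^±_μX_k`, `M_χX = X`), both grids, at the rate `ρ₃`
  have hDGj : ∀ k, HasMaj (BlockNorm.ofBlocks g (liftBlk blk ι)) (BlockNorm.ofBlocks g (liftBlk blk ι)) (Sum.elim (fun μ => fgrad n (liftEquiv (τ μ) ι)) (fun μ => bgrad n (liftEquiv (τ μ) ι)) j ∘ₗ (mulOp (fun p : X × ι => χX k p.1) ∘ₗ (projO none ∘ₗ bgPropV (stack (mulOp (fun p : X × ι => χtX k p.1) ∘ₗ N k) (fun j => Sum.elim (fun μ => fgrad n (liftEquiv (τ μ) ι)) (fun μ => bgrad n (liftEquiv (τ μ) ι)) j ∘ₗ (mulOp (fun p : X × ι => χtX k p.1) ∘ₗ N k))) (V k))))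
      (fun y y' => ind (Sk k) y * ind (Sk k) y' * (((β + (β₁ + ct * β)) * (1 - (β + (β₁ + ct * β)) * (R * cr) * cr)⁻¹) * Real.exp (-(ρ₃ * g.dist y y')))) := fun k => by
    rw [mulOp_comp_smoothCutDressed τ n (hχ k) (hNψ k) (hpair k).1]
    cases j with
    | inl μ => exact (hasMaj_fgrad_smoothCutDressed_loc₂ blk τ n htri hd hrow hσ hβ hβ₁ hct hR hcr hσρ hρ₁V hρ₁G hρ₂ hρ₂₁ (hSχ k) (hSψ k) (hχt k) (hdχt k) (hdχtb k) (hsub k) (hs k) (hsb k) (hdd k) (hddb k) (hs2 k) (hsb2 k) (hdd2 k) (hddb2 k) (hNψ k) (hcut k) (hcutF k) (hcutB k) (hV k) hq μ).mono fun y y' => weight_mul_exp_rate_mono (mul_nonneg (ind_nonneg _ _) (ind_nonneg _ _)) hB hρ₃₂ (hd y y')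
    | inr μ => exact (hasMaj_bgrad_smoothCutDressed_loc₂ blk τ n htri hd hrow hσ hβ hβ₁ hct hR hcr hσρ hρ₁V hρ₁G hρ₂ hρ₂₁ (hSχ k) (hSψ k) (hχt k) (hdχt k) (hdχtb k) (hsub k) (hs k) (hsb k) (hdd k) (hddb k) (hs2 k) (hsb2 k) (hdd2 k) (hddb2 k) (hNψ k) (hcut k) (hcutF k) (hcutB k) (hV k) hq μ).mono fun y y' => weight_mul_exp_rate_mono (mul_nonneg (ind_nonneg _ _) (ind_nonneg _ _)) hB hρ₃₂ (hd y y')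
  have hDGj' : ∀ k, HasMaj (BlockNorm.ofBlocks g (liftBlk (blk ∘ π) ι)) (BlockNorm.ofBlocks g (liftBlk (blk ∘ π) ι)) (Sum.elim (fun μ => fgrad n' (liftEquiv (τ' μ) ι)) (fun μ => bgrad n' (liftEquiv (τ' μ) ι)) j ∘ₗ (mulOp (fun p : X' × ι => χX' k p.1) ∘ₗ (projO none ∘ₗ bgPropV (stack (mulOp (fun p : X' × ι => χtX' k p.1) ∘ₗ N' k) (fun j => Sum.elim (fun μ => fgrad n' (liftEquiv (τ' μ) ι)) (fun μ => bgrad n' (liftEquiv (τ' μ) ι)) j ∘ₗ (mulOp (fun p : X' × ι => χtX' k p.1) ∘ₗ N' k))) (V' k))))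
      (fun y y' => ind (Sk k) y * ind (Sk k) y' * (((β + (β₁ + ct * β)) * (1 - (β + (β₁ + ct * β)) * (R * cr) * cr)⁻¹) * Real.exp (-(ρ₃ * g.dist y y')))) := fun k => by
    rw [mulOp_comp_smoothCutDressed τ' n' (hχ' k) (hNψ' k) (hpair' k).1]
    cases j with
    | inl μ => exact (hasMaj_fgrad_smoothCutDressed_loc₂ (blk ∘ π) τ' n' htri hd hrow hσ hβ hβ₁ hct hR hcr hσρ hρ₁V hρ₁G hρ₂ hρ₂₁ (hSχ' k) (hSψ' k) (hχt' k) (hdχt' k) (hdχtb' k) (hsub' k) (hs' k) (hsb' k) (hdd' k) (hddb' k) (hs2' k) (hsb2' k) (hdd2' k) (hddb2' k) (hNψ' k) (hcut' k) (hcutF' k) (hcutB' k) (hV' k) hq μ).mono fun y y' => weight_mul_exp_rate_mono (mul_nonneg (ind_nonneg _ _) (ind_nonneg _ _)) hB hρ₃₂ (hd y y')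
    | inr μ => exact (hasMaj_bgrad_smoothCutDressed_loc₂ (blk ∘ π) τ' n' htri hd hrow hσ hβ hβ₁ hct hR hcr hσρ hρ₁V hρ₁G hρ₂ hρ₂₁ (hSχ' k) (hSψ' k) (hχt' k) (hdχt' k) (hdχtb' k) (hsub' k) (hs' k) (hsb' k) (hdd' k) (hddb' k) (hs2' k) (hsb2' k) (hdd2' k) (hddb2' k) (hNψ' k) (hcut' k) (hcutF' k) (hcutB' k) (hV' k) hq μ).mono fun y y' => weight_mul_exp_rate_mono (mul_nonneg (ind_nonneg _ _) (ind_nonneg _ _)) hB hρ₃₂ (hd y y')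
  -- file 35: the two-grid defect of the jet rows (rate `ρ₃`)
  have hIDGj : ∀ k, HasMaj (BlockNorm.ofBlocks g (liftBlk blk ι)) (BlockNorm.ofBlocks g (liftBlk (blk ∘ π) ι))
      (idef (pull (liftMap π ι)) (pull (liftMap π ι)) (Sum.elim (fun μ => fgrad n' (liftEquiv (τ' μ) ι)) (fun μ => bgrad n' (liftEquiv (τ' μ) ι)) j ∘ₗ (mulOp (fun p : X' × ι => χX' k p.1) ∘ₗ (projO none ∘ₗ bgPropV (stack (mulOp (fun p : X' × ι => χtX' k p.1) ∘ₗ N' k) (fun j => Sum.elim (fun μ => fgrad n' (liftEquiv (τ' μ) ι)) (fun μ => bgrad n' (liftEquiv (τ' μ) ι)) j ∘ₗ (mulOp (fun p : X' × ι => χtX' k p.1) ∘ₗ N' k))) (V' k)))) (Sum.elim (fun μ => fgrad n (liftEquiv (τ μ) ι)) (fun μ => bgrad n (liftEquiv (τ μ) ι)) j ∘ₗ (mulOp (fun p : X × ι => χX k p.1) ∘ₗ (projO none ∘ₗ bgPropV (stack (mulOp (fun p : X × ι => χtX k p.1) ∘ₗ N k) (fun j => Sum.elim (fun μ => fgrad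 n (liftEquiv (τ μ) ι)) (fun μ => bgrad n (liftEquiv (τ μ) ι)) j ∘ₗ (mulOp (fun p : X × ι => χtX k p.1) ∘ₗ N k))) (V k)))))
      (fun y y' => ind (Sk k) y * ind (Sk k) y' * (((((m₀ + oχ * β) + (m₁ + oχ₁ * β₁ + ct * m₀ + oχ₂ * β)) * cr + 1 * (((m₀ + oχ * β) + (m₁ + oχ₁ * β₁ + ct * m₀ + oχ₂ * β)) * cr) * (R * ((β + (β₁ + ct * β)) * (1 - (β + (β₁ + ct * β)) * (R * cr) * cr)⁻¹) * cr) + (β + (β₁ + ct * β)) * o * cr * ((β + (β₁ + ct * β)) * (1 - (β + (β₁ + ct * β)) * (R * cr) * cr)⁻¹) * cr) * (1 - 1 * ((β + (β₁ + ct * β)) * (R * cr) * cr))⁻¹) * Real.exp (-(ρ₃ * g.dist y y')))) := fun k => by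
    have h35 := (hasMaj_idef_jet_smoothCutDressed_loc₂ blk π τ τ' n n' htri hd hrow hσ hcr hβ hβ₁ hct hm₀ hm₁ hoχ hoχ₁ hoχ₂ hR ho hσρ hρ₁V hρ₁G hρ₂ hρ₂₁ (hSχ k) (hSψ k) (hSχ' k) (hSψ' k) (hχt k) (hdχt k) (hdχtb k) (hsub k) (hs k) (hsb k) (hdd k) (hddb k) (hNψ k) (hχt' k) (hdχt' k) (hdχtb' k) (hsub' k) (hs' k) (hsb' k) (hdd' k) (hddb' k) (hNψ' k) (hfitχ k) (hfit₁ k) (hfit₁b k) (hfit₂ k) (hfit₂b k) (hcut k) (hcutF k) (hcutB k) (hcut' k) (hcutF' k) (hcutB' k) (hDcut k) (hDcutF k) (hDcutB k) (hV k) (hV' k) (hDV k) (hs2 k) (hsb2 k) (hdd2 k) (hddb2 k) (hs2' k) (hsb2' k) (hdd2' k) (hddb2' k) hq j).mono fun y y' =>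
      weight_mul_exp_rate_mono (mul_nonneg (ind_nonneg _ _) (ind_nonneg _ _)) hAD hρ₃₂ (hd y y')
    rw [← mulOp_comp_smoothCutDressed τ n (hχ k) (hNψ k) (hpair k).1, ← mulOp_comp_smoothCutDressed τ' n' (hχ' k) (hNψ' k) (hpair' k).1] at h35
    exact h35
  exact hasMaj_idef_comp_glued_of_cutRows_defect (liftBlk blk ι) (liftMap π ι) Sk htri hd hd0 hrow hσ hcr hB hB zero_le_one hc₁ hoo hos ho₁ hAD hAD (add_nonneg hθ hθF) (add_nonneg hε' hεF)
    (add_nonneg hr hrFK) (add_nonneg hrE hrFE) hNov hσρ₃ hleib hleib' hhcut hhcut' (fun k p => hhabs k p.1) (fun k p => hhabs' k p.1) hhs' hdh' (fun k p => hfh k p) hfits hfitd hN hGc hGc'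
    hDGj hDGj' hDGc hIDGj hKt hKt' hDKt hEt hEt' hDEt hq'

end Summit.QuantumFields.YangMills.BalabanUVNodes.N15.Gluing

end
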